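import Literature.MathematicalPhysics.QuantumFieldTheory.Balaban1983to89.B9Thm34AllKernelFinal
import Literature.MathematicalPhysics.QuantumFieldTheory.Balaban1983to89.B9Thm34AllUniform
import Literature.MathematicalPhysics.QuantumFieldTheory.Balaban1983to89.B9Thm34PPrimeKernelUniform

/-!
# `Balaban1983to89.B9Thm34AllKernelUniform` — [Balaban1985BackgroundPropagators] THEOREM 3.4 p. 400 FOR ALL FOUR OPERATORS NAMED IN IT, IN THE
# PRINTED KERNEL FORM, IN ONE STATEMENT, WITH THE CONSTANTS CHOSEN BEFORE THE LATTICE: `∃ a₁ > 0 ∃ B ∀ (T_η, k, {Ω_j}, U, …) ∀ α₁ ≦ a₁ ∀ A` —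
# `G′(U′U)` (four (3.42) kernel entries), `(Q′(U′U)G′²(U′U)Q′*(U′U))⁻¹` ((3.48) kernel bound), `R(U′U)` via `P(U′U) = I − R(U′U)` (four (3.49) kernel
# entries) and `P′(A)` (four (3.68) kernel entries), the (3.65) remainders, `G(U′U)` (four (3.42) kernel entries) — ONE `a₁`, ONE `B`, ONE `C⁻¹(U′U)`;
# the uniformity «the constants in the formulations of both theorems do not depend on the sequence {Ω_j}» (p. 399) made a theorem for FILE 31's
# kernel-form one-name capstone (FILE 53 of the Sect. B programme of cell `lit-balaban`, seat r06 gen 21; the kernel-form twin of FILE 48)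

statement-level skeleton of published theorems with citation tags; proofs where landed; nothing here is a claim about the Yang–Mills mass gap

CITATION HEADER (lean-in-tree rule).  B9 = T. Bałaban, *Propagators for lattice gauge theories in a background field*, Commun. Math. Phys.
**99** (1985) 389–434 [Balaban1985BackgroundPropagators] (held `paper:balaban1985-cmp99-background-propagators`; journal page = PDF page + 388):
Theorem 3.4 p. 400 [PDF 12] L7–10 «There exists a positive constant a₁ such that the operators G′(U), (Q′(U)G′²(U)Q′*(U))⁻¹, R(U), G(U) extend
to configurations U′U for α₁ ≦ a₁ as analytic functions of A. The extended operators satisfy all the inequalities of Theorems 3.1–3.3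
correspondingly»; Theorem 3.1 p. 397 [PDF 9] «There exist positive constants M₁, δ₀, a₀, B₀ dependent on d and L only» and (3.42); Theorem 3.2
(3.48) p. 398; (3.49) p. 399; Theorem 3.3 p. 399 (the printed KERNEL shapes = `B6RandomWalkKernel.HasKernelBound`, kernels for the pairing of p. 393,
block volume weight `v(y′) = (L^{j′}η)^d`); p. 399 [PDF 11] L1–3 «Let us stress that the constants in the formulations of both theorems do not depend
on the sequence {Ω_j}, j = 0, 1, …, k, if the conditions (2.1), (2.2) are satisfied»; Sect. B pp. 400–407: (3.60)–(3.68) pp. 402–403 («of course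
with different constants», p. 403, L5–6; «the remainders G′(U)V′(A)G′(U′U) and G′(U′U)V′(A)G′(U) in (3.65) … satisfy Theorem 3.1 with the additional
small factor O(1)α₁», p. 403 L7–9; «Moreover we have P(U′U) = P(U) + P′(A), [(3.68)]», p. 403), (3.82)–(3.86) p. 407 («This way we get all these
inequalities for the operator G(U′U), the local ones follow from the bound (3.85) and Lemma 2.1 [4]. Thus Theorem 3.4 is proved, assuming that
Theorems 3.1–3.3 hold.», p. 407); p. 398 remark after (3.47) (scale transfer).  [4] = [Balaban1984PropagatorsII] T. Bałaban, *Propagators and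
renormalization transformations for lattice gauge theories. II*, Commun. Math. Phys. **96** (1984) 223–250: Lemma 2.1 p. 234 [PDF 12] (no
dependence on the torus, k or {Ω_j}), (2.51)–(2.55) p. 232, (2.66) p. 234, (2.68) p. 235.  Every locator of FILE 48's header applies to the carried
hypotheses.  Rows B9.Thm3.4 × B9.Thm3.1 × B9.Thm3.2 × B9.Eq3.49 × B9.Eq3.68 × B9.Thm3.3 (cells only; no row head changes).

WHY THIS FILE (B9-CLOSURE §3 item 4 / v3.3: «what keeps the per-lattice shape (same recipe): the kernel-form capstones FILES 29–33 …»; FILE 31 HONEST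
SCOPE (e) «`a₁`, `B` packaged existentially after the lattice is fixed»; INTERFACES-r06 §46/§47 RECIPE).  FILE 48 (r06 gen 20) re-quantified the
block-majorant one-name capstone `thm34_all_final`; this file does the same for the KERNEL-FORM one-name capstone `thm34_all_kernel_final'` (FILE 31
v1.1, the ONE-NAME OFFER IN KERNEL FORM of INTERFACES-r06 §33): the p. 398 / [4] Lemma 2.1 scale transfer is hypothesised in its printed uniform form
(ONE function `Λ : (0,∞) → [1,∞)` for the family) and the quantifiers are re-ordered; FILE 31's per-lattice callees are replaced by their uniform
twins — FILE 48 `thm34_all_uniform`, FILE 49 `thm34_Gp_kernel_uniform`, FILE 51 `thm34_P_kernel_uniform`, FILE 52 `thm34_pPrime_kernel_uniform`, FILE 50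
`remainder365_kernel_uniform` — invoked before the lattice.  WITH THIS FILE the kernel-form half of the uniformity programme (FILES 49–53) is complete:
every sup/kernel member Theorem 3.4 names for the four operators is a theorem with ONE `a₁` and ONE `B` chosen BEFORE the lattice.

WHAT IS PROVED (2 theorems: 0 `def`, 0 sorry, 0 new named facts; standard axioms).
* **`thm34_all_kernel_uniform`** — FILE 31 `thm34_all_kernel_final` ((i) `G′(U′U)` = two-sided inverse of `Δ′_a(U) − V′(A)` with the four (3.42)
  kernel entries at `(B, 4δ₀/5)`; `∃ C⁻¹(U′U) G(U′U)`: (ii) two-sided inverse of `Q′(U′U)G′²(U′U)Q′*(U′U)` with the (3.48) kernel bound at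
  `(B, 9δ₀/25)`; (ii′) the four (3.49) kernel entries of `P(U′U)` (THIS `C⁻¹(U′U)`) at `(B, δ₀/5)`; (iii) `G(U′U)` = two-sided inverse of the
  concrete `Δ_a(U′U)` with the four (3.42) kernel entries at `(B, δ₀/10)`) with the quantifier order `∃ a₁ > 0 ∃ B ≧ 0 ∀ S T U g blk kQ sQ cfun w
  (axioms, [4] Lemma 2.1, scale transfer with the GIVEN Λ(·), commuting translations, (3.35), stencils, (3.15)/(3.19)/(3.24)/(3.60) data, Theorem 3.1
  for G′(U) = (Δ′_a(U))⁻¹, the (3.19) letters with a section, Theorem 3.2, Theorem 3.3 block AND kernel members, Theorem 3.1's kernel members) ∀ α₁ ≦ a₁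
  ∀ A ∈ (3.37) ∀ kF sF ∀ (3.57)/(3.59) letters ∀ (3.80)–(3.82) letters` — hypotheses inside the `∀` = FILE 31's (= FILE 28's + the four `G′(U)` kernel
  letters) VERBATIM (named binders), less `hrepr` (moved before) and with `hST` in the uniform form.
* **`thm34_all_kernel_uniform'`** — FILE 31 v1.1 `thm34_all_kernel_final'` (the above PLUS, with the SAME `C⁻¹(U′U)`, `a₁`, `B`: (iv) the four
  (3.68) kernel entries of `P′(A)` at `(Bα₁, δ₀/5)` and `P(U′U) = P(U) + P′(A)`; (v) both (3.65) remainders `= G′(U′U) − G′(U)` with the four (3.42)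
  kernel entries at `(Bα₁, 4δ₀/5)`) with the same quantifier order — THE UNIFORM ONE-NAME OFFER IN KERNEL FORM.  (FILE 31's per-lattice statements
  follow by instantiation with `Λf := fun _ => Λ`.)

PROOF.  FILE 31's proofs verbatim after the re-ordering (scripted: `work/unif.py` + `work/gen53.py` in the seat folder): the uniform callees BEFORE
the lattice (`a₁ = min` of three, `B = sum` of three, as in FILE 31); inside, their `∀`-clauses are applied to the lattice data
(`replace h := h T U blk …`), the `C⁻¹(U′U)` of FILES 51/52 identified with FILE 48's by Mathlib `left_inv_eq_right_inv`, constants and rates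
weakened to the common `B` exactly as in FILE 31.

HONEST SCOPE / NOT CLAIMED.  As FILE 31/FILE 48: (a) Theorems 3.1–3.3 FOR `U` are INPUTS — the file certifies Sect. B's implication («Thus Theorem
3.4 is proved, assuming that Theorems 3.1–3.3 hold», p. 407) with the print's quantifier order; the heads B9.Thm3.1/3.2/3.3/3.4 stay
`typed-existing`; (b) the Hölder / L² members (3.43)–(3.46) for the extended operators are FILES 34–44's business (per-lattice shape kept there); (c)
the rates `4δ₀/5`, `9δ₀/25`, `δ₀/5`, `δ₀/10` and the exponents are ONE admissible bookkeeping of «of course with different constants»; (d) the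
uniformity displayed is uniformity in `(S, T, 𝔅, blk)`, `U`, the operators, the letters, the section `rep` and the kernel weights `(v, c)` AT FIXED
input constants `(δ₀, B₀, κ_Q, B_G, B₁, c_F, C_q, a₀, C₀, d₀, M₂, κ_Qb, c_Fb, ā, Λ(·))`, `κ`, `(𝔸, b)` — the print's «dependent on d and L only» is
this composed with Theorems 3.1–3.3's own uniformity and [4] Lemma 2.1; (e) analyticity in `A` = the finite-lattice algebra of the Neumann series;
(f) (3.37) read blockwise in FILE 28's fourteen shapes.  THE UNIFORM ONE-NAME OFFER IN KERNEL FORM: `thm34_all_kernel_uniform'`; for a single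
lattice FILE 31's `thm34_all_kernel_final'` remains the right name.  NOT summit progress.

RELATED IN THE TREE, NOT DUPLICATED (searched 2026-08-23: `lean search 'all_kernel_uniform' --decl` = ∅): FILE 31 `B9Thm34AllKernelFinal`
(`thm34_all_kernel_final`/`thm34_all_kernel_final'`, per-lattice), FILE 48 `B9Thm34AllUniform.thm34_all_uniform`, FILE 49 `B9Thm34GpKernelUniform`,
FILE 50 `B9Eq365RemainderKernelUniform`, FILE 51 `B9Thm34PKernelUniform`, FILE 52 `B9Thm34PPrimeKernelUniform` — all USED BY NAME; no existing
module modified.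
-/

noncomputable section

namespace Literature.MathematicalPhysics.QuantumFieldTheory.Balaban1983to89.B9Thm34AllKernelUniform

open NormedSpace Complex
open Literature.MathematicalPhysics.QuantumFieldTheory.Balaban1983to89
open Literature.MathematicalPhysics.QuantumFieldTheory.Balaban1983to89.B6RandomWalk (HasMajorant hasMajorant_mono Triangle254 Ineq261)
open Literature.MathematicalPhysics.QuantumFieldTheory.Balaban1983to89.B6RandomWalkHom (HasMajorantHom hasMajorantHom_mono)
open Literature.MathematicalPhysics.QuantumFieldTheory.Balaban1983to89.B6RandomWalkKernel (HasKernelBound hasKernelBound_mono)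
open Literature.MathematicalPhysics.QuantumFieldTheory.Balaban1983to89.B9Thm34Ext (toB6)
open Literature.MathematicalPhysics.QuantumFieldTheory.Balaban1983to89.B9Ineq347 (ScaleTransfer)
open Literature.MathematicalPhysics.QuantumFieldTheory.Balaban1983to89.B9Eq386Neumann (pTwo deltaA)
open Literature.MathematicalPhysics.QuantumFieldTheory.Balaban1983to89.B9Eq39Adjoint
open Literature.MathematicalPhysics.QuantumFieldTheory.Balaban1983to89.B9Eq369Small (Through)
open Literature.MathematicalPhysics.QuantumFieldTheory.Balaban1983to89.B9Eq372Locality (stBonds)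
open Literature.MathematicalPhysics.QuantumFieldTheory.Balaban1983to89.B9Eq352DivForm (tauF tauB)
open Literature.MathematicalPhysics.QuantumFieldTheory.Balaban1983to89.B9Eq352DivFormLetters
open Literature.MathematicalPhysics.QuantumFieldTheory.Balaban1983to89.B9Eq352GradLetters (diffLetter)
open Literature.MathematicalPhysics.QuantumFieldTheory.Balaban1983to89.B9Eq371GradLetters (bT bU)
open Literature.MathematicalPhysics.QuantumFieldTheory.Balaban1983to89.B9Eq372RemLetters (lapDDLetter)
open Literature.MathematicalPhysics.QuantumFieldTheory.Balaban1983to89.B9Eq382V3Letters (dPrimeLetter)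
open Literature.MathematicalPhysics.QuantumFieldTheory.Balaban1983to89.B9Eq376POneLetters (conjHom gradLin divLin)
open Literature.MathematicalPhysics.QuantumFieldTheory.Balaban1983to89.B9Eq360Vprime (gPrimeExtEnd)
open Literature.MathematicalPhysics.QuantumFieldTheory.Balaban1983to89.B9Eq360VprimeLetters (vPrimeConc)
open Literature.MathematicalPhysics.QuantumFieldTheory.Balaban1983to89.B6RandomWalkSection (secExt secRes secConj)
open Literature.MathematicalPhysics.QuantumFieldTheory.Balaban1983to89.B9Thm34AllUniform (thm34_all_uniform)
open Literature.MathematicalPhysics.QuantumFieldTheory.Balaban1983to89.B9Thm34GpKernelUniform (thm34_Gp_kernel_uniform)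
open Literature.MathematicalPhysics.QuantumFieldTheory.Balaban1983to89.B9Thm34PKernelUniform (thm34_P_kernel_uniform)
open Literature.MathematicalPhysics.QuantumFieldTheory.Balaban1983to89.B9Thm34PPrimeKernelUniform (thm34_pPrime_kernel_uniform)
open Literature.MathematicalPhysics.QuantumFieldTheory.Balaban1983to89.B9Eq365RemainderKernelUniform (remainder365_kernel_uniform)

/-! ## Theorem 3.4 for ALL FOUR operators in the printed kernel form with `a₁`, `B` chosen before the lattice -/

section AllU

variable {𝔸 : Type*} [NormedRing 𝔸] [NormedAlgebra ℂ 𝔸] [CompleteSpace 𝔸] {ι : Type} [Fintype ι]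
variable (b : Module.Basis ι ℝ 𝔸) (κ : Type) [Fintype κ] [LinearOrder κ]

set_option maxHeartbeats 1600000 in
/-- **THEOREM 3.4 (p. 400) FOR ALL FOUR OPERATORS NAMED IN IT, IN THE PRINTED KERNEL FORM — ONE `a₁`, ONE `B`, ONE `C⁻¹(U′U)`, THE CONSTANTS CHOSEN
BEFORE THE LATTICE.**  «There exists a positive constant a₁ such that the operators G′(U), (Q′(U)G′²(U)Q′*(U))⁻¹, R(U), G(U) extend to configurations
U′U for α₁ ≦ a₁ as analytic functions of A. The extended operators satisfy all the inequalities of Theorems 3.1–3.3 correspondingly.»; p. 399 «the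
constants … do not depend on the sequence {Ω_j}».  For fixed `d`, `κ`, `(𝔸, b, M₂)`, the input constants and ONE scale-transfer function `Λ(·) ≧ 1`:
`∃ a₁ > 0 ∃ B ≧ 0 ∀ (lattice 𝔅 = g, background U, data, Theorems 3.1–3.3 for U incl. the kernel members) ∀ α₁ ≦ a₁ ∀ A ∈ (3.37) ∀ (3.57)/(3.59)
letters ∀ (3.80)–(3.82) letters`: (i) `G′(U′U)`: two-sided inverse of `Δ′_a(U) − V′(A)` + the four (3.42) kernel entries
`B[(Lʲη)², Lʲη, Lʲη, 1](L^{j′}η)^{−d}e^{−(4δ₀/5)d}` ∧ `∃ C⁻¹(U′U) G(U′U)`: (ii) two-sided inverse of `Q′(U′U)G′²(U′U)Q′*(U′U)` with the (3.48) kernel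
bound `B(Lʲη)⁻⁴(L^{j′}η)^{−d}e^{−(9δ₀/25)d}` ∧ (ii′) the four (3.49) kernel entries `B[1, (Lʲη)⁻¹, (Lʲη)⁻¹, (Lʲη)⁻²](L^{j′}η)^{−d}e^{−(δ₀/5)d}` of
`P(U′U)` built with THIS `C⁻¹(U′U)` ∧ (iii) `G(U′U)`: two-sided inverse of the concrete `Δ_a(U′U)` + the four (3.42) kernel entries at `(B, δ₀/10)`
— FILE 31 `thm34_all_kernel_final` verbatim, re-quantified.  Proof: FILES 48, 49, 51 (uniform twins) before the lattice + Mathlib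
`left_inv_eq_right_inv` for the two `C⁻¹(U′U)`; `a₁ = min` of three, `B = B₄₈ + B₄₉ + B₅₁`.
[cite: Balaban1985BackgroundPropagators, Thm 3.4 p.400 + p.399 + Thm 3.1 (3.42) p.397 + Thm 3.2 (3.48) p.398 + (3.49) p.399 + Thm 3.3 p.399 + (3.60)–(3.68) pp.402–403 + (3.82)–(3.86) p.407 + p.398 remark + (3.15)/(3.19)/(3.21)/(3.24)/(3.25) pp.393–394 + (3.57) p.401 + (3.35)/(3.37) p.396; Balaban1984PropagatorsII, Lemma 2.1 p.234 + (2.51)–(2.55) p.232 + (2.66) p.234 + (2.68) p.235; Balaban1985Variational, (135) p.298] -/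
theorem thm34_all_kernel_uniform [DecidableEq ι] (d : ℕ)
    (δ₀ B₀ κQ BG B₁ cF Cq a₀ C₀ d₀ M₂ κQb cFb abar : ℝ) (Λf : ℝ → ℝ)
    (hB₀ : 0 ≤ B₀) (hκQ : 0 < κQ) (hBG : 0 < BG) (hB₁ : 0 < B₁) (hcF : 0 < cF) (hCq : 0 ≤ Cq) (ha₀ : 0 ≤ a₀) (hC₀ : 0 ≤ C₀)
    (hM₂ : 0 ≤ M₂) (hδ₀ : 0 < δ₀) (hκQb : 0 ≤ κQb) (hcFb : 0 ≤ cFb) (habar : 0 ≤ abar) (hΛf : ∀ α : ℝ, 0 < α → 1 ≤ Λf α)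
    (hrepr : ∀ (v : 𝔸) (i : ι), |b.repr v i| ≤ M₂ * ‖v‖) :
    ∃ a₁ : ℝ, 0 < a₁ ∧ ∃ B : ℝ, 0 ≤ B ∧
    ∀ {S : Type} [Fintype S] [DecidableEq S] (T : κ → Equiv.Perm S) (U : κ → S → 𝔸ˣ)
      {g : B9.Geometry} [Fintype g.Site] [DecidableEq g.Site] [Nonempty g.Site] {Rr : ℝ} {H : Prop} (blk : S → g.Site)
      (kQ : g.Site → S → 𝔸 →L[ℝ] 𝔸) (sQ : S → 𝔸 →L[ℝ] 𝔸) (cfun w : g.Site → ℝ)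
    -- the multiscale geometry 𝔅 (p. 393, [4] (2.1)–(2.4)) and its axioms
    (hdnn : ∀ a a' : g.Site, 0 ≤ g.dist a a') (htri : Triangle254 (toB6 g Rr H)) (hrefl : ∀ y : g.Site, g.dist y y = 0)
    (hsym : ∀ y y' : g.Site, g.dist y y' = g.dist y' y) (hlen : ∀ y : g.Site, 0 < g.len y) (hlenη : ∀ y : g.Site, g.eta ≤ g.len y)
    (hη : 0 < g.eta) (hL : 1 ≤ g.L)
    -- [4] Lemma 2.1 (2.61) at the rate `δ₀`, «for every 0 < α < 1»
    (h261 : ∀ α : ℝ, 0 < α → α < 1 → Ineq261 d (toB6 g Rr H) δ₀ α)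
    -- p. 398: «Using Lemma 2.1 in [4] we may replace the factor (Lʲη)^α by (Lʲη)^β(L^{j′}η)^γ with β + γ = α» — for every exponent, one
    -- constant `Λ(α) ≧ 1` for the six weights `(Lʲη)^{1,2,−1,−2,−4}` (natural and real powers)
      (hST : ∀ α : ℝ, 0 < α → ScaleTransfer g δ₀ α (Λf α) (fun a => g.len a) ∧ ScaleTransfer g δ₀ α (Λf α) (fun a => g.len a ^ 2) ∧
        ScaleTransfer g δ₀ α (Λf α) (fun a => (g.len a)⁻¹) ∧ ScaleTransfer g δ₀ α (Λf α) (fun a => (g.len a ^ 2)⁻¹) ∧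
        ScaleTransfer g δ₀ α (Λf α) (fun a => (g.len a ^ 4)⁻¹) ∧ ScaleTransfer g δ₀ α (Λf α) (fun y => g.len y ^ (-(4 : ℝ))))
    -- real coordinates of `𝔸`, commuting translations, unitary-type background
    (hT : ∀ (μ ν : κ) (x : S), T μ (T ν x) = T ν (T μ x))
    (hU1 : ∀ m z, ‖((U m z : 𝔸ˣ) : 𝔸)‖ ≤ 1 ∧ ‖(((U m z)⁻¹ : 𝔸ˣ) : 𝔸)‖ ≤ 1)
    -- (3.35) on the plaquettes through each bond, at that bond's block scale; stencil geometry at range `d₀`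
    (h35 : ∀ μ x m n y, Through T μ x m n y → ‖(plaqU T U m n y : 𝔸) - 1‖ ≤ C₀ * ((g.L ^ g.scale (blk x))⁻¹) ^ 2)
    (hd₀B : ∀ μ x, g.dist (blk x) (blk ((T μ).symm x)) ≤ d₀) (hd₀F : ∀ μ x, g.dist (blk x) (blk (T μ x)) ≤ d₀)
    (hd₀FB : ∀ μ ν x, g.dist (blk x) (blk ((T ν).symm (T μ x))) ≤ d₀)
    (hd₀st : ∀ μ x (q : κ × S), q ∈ stBonds T μ x → g.dist (blk x) (blk q.2) ≤ d₀)
    (hd₀loc : ∀ μ x (q : κ × S), q ∈ B9Eq375Locality.locBondsA' T μ x → g.dist (blk x) (blk q.2) ≤ d₀)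
    (hd₀0 : ∀ y : g.Site, g.dist y y ≤ d₀)
    -- the `A`-independent data of the concrete `V′(A)` of (3.60): (3.19) kernels/multipliers and the `a`-weights of (3.24)
    (hw : ∀ y, 0 ≤ w y) (hcard : ∀ y, ((B9Eq360Vprime.block blk y).card : ℝ) * w y ≤ 1)
    (hkQ : ∀ y x, blk x = y → ‖kQ y x‖ ≤ w y) (hsQ : ∀ x, ‖sQ x‖ ≤ 1) (hcfun : ∀ y, |cfun y| ≤ a₀ * (g.len y ^ 2)⁻¹)
    -- THEOREM 3.1 for `G′(U)`: (3.42)₁,₂,₃ at the rate `δ₀`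
    {Gp : Module.End ℝ (S × ι → ℝ)}
    (h342_1 : HasMajorant (g := toB6 g Rr H) (fun p : S × ι => blk p.1) Gp
      (fun a a' => BG * g.len a ^ 2 * Real.exp (-(δ₀ * g.dist a a'))))
    (h342_2 : ∀ k : κ ⊕ κ, HasMajorant (g := toB6 g Rr H) (fun p : S × ι => blk p.1)
      (conj b (diffLetter T U ((g.eta : ℂ)⁻¹) k) * Gp) (fun a a' => BG * g.len a * Real.exp (-(δ₀ * g.dist a a'))))
    (h342_3 : ∀ k : κ ⊕ κ, HasMajorant (g := toB6 g Rr H) (fun p : S × ι => blk p.1)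
      (Gp * conj b (diffLetter T U ((g.eta : ℂ)⁻¹) k)) (fun a a' => BG * g.len a * Real.exp (-(δ₀ * g.dist a a'))))
    -- (3.24): `G′(U) = (Δ′_a(U))⁻¹` for the letter `Δ′_a(U)`
    {Δp : Module.End ℝ (S × ι → ℝ)} (hΔpGp : Δp * Gp = 1) (hGpΔp : Gp * Δp = 1)
    -- the (3.19) letters `Q′(U)`, `Q′*(U)` in their own typing with block-local two-space majorants, a section of the block map (FILE 17)
    (rep : g.Site → S × ι) (hrep : ∀ y : g.Site, blk (rep y).1 = y)
    {Qc : (S × ι → ℝ) →ₗ[ℝ] (g.Site → ℝ)} {Qcs : (g.Site → ℝ) →ₗ[ℝ] (S × ι → ℝ)} {Linv : Module.End ℝ (g.Site → ℝ)}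
    (hQc : HasMajorantHom (g := toB6 g Rr H) (fun p : S × ι => blk p.1) (fun y : g.Site => y) Qc
      (fun a a' : g.Site => κQ * (if a = a' then (1 : ℝ) else 0)))
    (hQcs : HasMajorantHom (g := toB6 g Rr H) (fun y : g.Site => y) (fun p : S × ι => blk p.1) Qcs
      (fun a a' : g.Site => κQ * (if a = a' then (1 : ℝ) else 0)))
    -- THEOREM 3.2 for `U`: (3.21) `C⁻¹ = (Q′G′²Q′*)⁻¹` exists (`hLinv`) with the KERNEL bound (3.48) at the rate `δ₀`
    (hLinv : (Qc ∘ₗ (Gp * Gp) ∘ₗ Qcs) * Linv = 1)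
    (h348 : ∀ y y' : g.Site, |B9Thm34Inv.ker (B9Thm34Inv.vol g d) Linv y y'| ≤
      B₁ * g.len y ^ (-(4 : ℝ)) * g.len y' ^ (-(d : ℝ)) * Real.exp (-(δ₀ * g.dist y y')))
    -- the (3.15) bond letters `Q(U)`, `Q*(U)` and the weight letter `a` of (3.24)/(3.26), with their majorants
    {G Qs Q a : Module.End ℝ ((κ × S) × ι → ℝ)}
    (hQb : HasMajorant (g := toB6 g Rr H) (fun q : (κ × S) × ι => blk q.1.2) Q (fun a a' => κQb * Real.exp (-(δ₀ * g.dist a a'))))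
    (hQsb : HasMajorant (g := toB6 g Rr H) (fun q : (κ × S) × ι => blk q.1.2) Qs (fun a a' => κQb * Real.exp (-(δ₀ * g.dist a a'))))
    (ha324 : HasMajorant (g := toB6 g Rr H) (fun q : (κ × S) × ι => blk q.1.2) a
      (fun a a' : g.Site => if a = a' then abar * (g.len a ^ 2)⁻¹ else 0))
    -- THEOREM 3.3 for `G(U)`: two-sided inverse of the concrete `Δ_a(U)` and its (3.42)-entries at the rate `δ₀`
    (hΔG : deltaA (conj b (lapDDLetter T ((g.eta : ℂ)⁻¹) U)) (conj b (dPrimeLetter T U g.eta))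
      (conjHom b (gradLin T ((g.eta : ℂ)⁻¹) U) ∘ₗ (1 - (Gp ∘ₗ Qcs ∘ₗ Linv ∘ₗ Qc ∘ₗ Gp)) ∘ₗ conjHom b (divLin T ((g.eta : ℂ)⁻¹) U)) Qs a Q * G = 1)
    (hGΔ : G * deltaA (conj b (lapDDLetter T ((g.eta : ℂ)⁻¹) U)) (conj b (dPrimeLetter T U g.eta))
      (conjHom b (gradLin T ((g.eta : ℂ)⁻¹) U) ∘ₗ (1 - (Gp ∘ₗ Qcs ∘ₗ Linv ∘ₗ Qc ∘ₗ Gp)) ∘ₗ conjHom b (divLin T ((g.eta : ℂ)⁻¹) U)) Qs a Q = 1)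
    (hG : HasMajorant (g := toB6 g Rr H) (fun q : (κ × S) × ι => blk q.1.2) G
      (fun a a' => B₀ * g.len a ^ 2 * Real.exp (-(δ₀ * g.dist a a'))))
    (hDG : ∀ k : κ ⊕ κ, HasMajorant (g := toB6 g Rr H) (fun q : (κ × S) × ι => blk q.1.2)
      (conj b (diffLetter (bT T) (bU U) ((g.eta : ℂ)⁻¹) k) * G) (fun a a' => B₀ * g.len a * Real.exp (-(δ₀ * g.dist a a'))))
    (hGD : ∀ k : κ ⊕ κ, HasMajorant (g := toB6 g Rr H) (fun q : (κ × S) × ι => blk q.1.2)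
      (G * conj b (diffLetter (bT T) (bU U) ((g.eta : ℂ)⁻¹) k)) (fun a a' => B₀ * g.len a * Real.exp (-(δ₀ * g.dist a a'))))
    -- NEW (kernel form): Theorem 3.3's (3.42)₁,₂,₃,₄ for `G(U)` as PRINTED KERNEL BOUNDS (pairing weight `c = η^d`, volume weight `v(y′) = (L^j′ η)^d`)
    {v : g.Site → ℝ} (hv : ∀ y, 0 < v y) {c : ℝ} (hc : 0 < c)
    (hGk : HasKernelBound (g := toB6 g Rr H) (fun q : (κ × S) × ι => blk q.1.2) v c G
      (fun a a' => B₀ * g.len a ^ 2 * Real.exp (-(δ₀ * g.dist a a'))))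
    (hDGk : ∀ k : κ ⊕ κ, HasKernelBound (g := toB6 g Rr H) (fun q : (κ × S) × ι => blk q.1.2) v c
      (conj b (diffLetter (bT T) (bU U) ((g.eta : ℂ)⁻¹) k) * G) (fun a a' => B₀ * g.len a * Real.exp (-(δ₀ * g.dist a a'))))
    (hGDk : ∀ l : κ ⊕ κ, HasKernelBound (g := toB6 g Rr H) (fun q : (κ × S) × ι => blk q.1.2) v c
      (G * conj b (diffLetter (bT T) (bU U) ((g.eta : ℂ)⁻¹) l)) (fun a a' => B₀ * g.len a * Real.exp (-(δ₀ * g.dist a a'))))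
    (hDGDk : ∀ k l : κ ⊕ κ, HasKernelBound (g := toB6 g Rr H) (fun q : (κ × S) × ι => blk q.1.2) v c
      (conj b (diffLetter (bT T) (bU U) ((g.eta : ℂ)⁻¹) k) * G * conj b (diffLetter (bT T) (bU U) ((g.eta : ℂ)⁻¹) l)) (fun a a' => B₀ * Real.exp (-(δ₀ * g.dist a a'))))
    -- NEW (kernel form, FILES 29/30): Theorem 3.1's (3.42)₁,₂,₃,₄ for `G′(U)` as PRINTED KERNEL BOUNDS on the sites (same pairing `c`, volume `v`)
    (hGpk : HasKernelBound (g := toB6 g Rr H) (fun p : S × ι => blk p.1) v c Gp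
      (fun a a' => BG * g.len a ^ 2 * Real.exp (-(δ₀ * g.dist a a'))))
    (hDGpk : ∀ k : κ ⊕ κ, HasKernelBound (g := toB6 g Rr H) (fun p : S × ι => blk p.1) v c
      (conj b (diffLetter T U ((g.eta : ℂ)⁻¹) k) * Gp) (fun a a' => BG * g.len a * Real.exp (-(δ₀ * g.dist a a'))))
    (hGpDk : ∀ l : κ ⊕ κ, HasKernelBound (g := toB6 g Rr H) (fun p : S × ι => blk p.1) v c
      (Gp * conj b (diffLetter T U ((g.eta : ℂ)⁻¹) l)) (fun a a' => BG * g.len a * Real.exp (-(δ₀ * g.dist a a'))))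
    (hDGpDk : ∀ k l : κ ⊕ κ, HasKernelBound (g := toB6 g Rr H) (fun p : S × ι => blk p.1) v c
      (conj b (diffLetter T U ((g.eta : ℂ)⁻¹) k) * Gp * conj b (diffLetter T U ((g.eta : ℂ)⁻¹) l)) (fun a a' => BG * Real.exp (-(δ₀ * g.dist a a')))),
    ∀ (α₁ : ℝ), 0 ≤ α₁ → α₁ ≤ a₁ →
    -- the exponent field `A` in the domain (3.37), read blockwise in the shapes of FILES 1–19, and the `A`-dependent (3.59) data `kF`, `sF`
    ∀ (A : κ → S → 𝔸) (kF : g.Site → S → 𝔸 →L[ℝ] 𝔸) (sF : S → 𝔸 →L[ℝ] 𝔸),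
      (∀ y x, blk x = y → ‖kF y x‖ ≤ Cq * α₁ * w y) → (∀ x, ‖sF x‖ ≤ Cq * α₁) →
      (∀ ν k x, ‖((g.eta : ℂ)⁻¹) • covDstar T U ν (A k) x‖ ≤ α₁ * (g.len (blk x) ^ 2)⁻¹) →
      (∀ μ ν x, ‖((g.eta : ℂ)⁻¹) • covD T U μ (A ν) x‖ ≤ α₁ * (g.len (blk x) ^ 2)⁻¹) →
      (∀ μ ν x, ‖((g.eta : ℂ)⁻¹) • covDstar T U ν (A ν) (T μ x)‖ ≤ α₁ * (g.len (blk x) ^ 2)⁻¹) →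
      (∀ μ x, ‖((g.eta : ℂ)⁻¹) • covDstar T U μ (tauB T U μ (A μ)) x‖ ≤ α₁ * (g.len (blk x) ^ 2)⁻¹) →
      (∀ μ ν k x, ‖((g.eta : ℂ)⁻¹) • covD T U μ (A k) ((T ν).symm x)‖ ≤ α₁ * (g.len (blk x) ^ 2)⁻¹) →
      (∀ k x, ‖A k x‖ ≤ α₁ * (g.len (blk x))⁻¹) → (∀ ν k x, ‖tauB T U ν (A k) x‖ ≤ α₁ * (g.len (blk x))⁻¹) →
      (∀ μ k x, ‖tauF T U μ (A k) x‖ ≤ α₁ * (g.len (blk x))⁻¹) →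
      (∀ k μ ν x, ‖A k ((T ν).symm (T μ x))‖ ≤ α₁ * (g.len (blk x))⁻¹) →
      (∀ μ x m z, (m, z) ∈ stBonds T μ x → ‖A m z‖ ≤ α₁ * (g.len (blk x))⁻¹) →
      (∀ μ x m z, (m, z) ∈ B9Eq375Locality.locBondsA T μ x → ‖A m z‖ ≤ α₁ * (g.len (blk x))⁻¹) →
      (∀ μ x m n y, Through T μ x m n y →
        ‖covD T U m (A n) y‖ ≤ g.eta * (α₁ * ((g.len (blk x))⁻¹) ^ 2) ∧ ‖covD T U n (A m) y‖ ≤ g.eta * (α₁ * ((g.len (blk x))⁻¹) ^ 2)) →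
    -- the (3.57)/(3.59) letters `F′₂(A)`, `F′₂*(A)` (block-local, size `c_F α₁`)
    ∀ {Qc' Fc : (S × ι → ℝ) →ₗ[ℝ] (g.Site → ℝ)} {Qcs' Fcs : (g.Site → ℝ) →ₗ[ℝ] (S × ι → ℝ)},
      Qc' = Qc + Fc → Qcs' = Qcs + Fcs →
      HasMajorantHom (g := toB6 g Rr H) (fun p : S × ι => blk p.1) (fun y : g.Site => y) Fc
        (fun a a' : g.Site => cF * α₁ * (if a = a' then (1 : ℝ) else 0)) →
      HasMajorantHom (g := toB6 g Rr H) (fun y : g.Site => y) (fun p : S × ι => blk p.1) Fcs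
        (fun a a' : g.Site => cF * α₁ * (if a = a' then (1 : ℝ) else 0)) →
    -- the (3.80)–(3.81) letters `F₂(A)`, `F₂*(A)` («|F₂(A)|, |F₂*(A)| ≦ O(1)α₁»), `P₂(A)` of (3.82)
    ∀ {P₂ Qs' Q' F₂ F₂s : Module.End ℝ ((κ × S) × ι → ℝ)},
      Q' = Q + F₂ → Qs' = Qs + F₂s → P₂ = pTwo Qs Q F₂ F₂s a →
      HasMajorant (g := toB6 g Rr H) (fun q : (κ × S) × ι => blk q.1.2) F₂ (fun a a' => cFb * α₁ * Real.exp (-(δ₀ * g.dist a a'))) →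
      HasMajorant (g := toB6 g Rr H) (fun q : (κ × S) × ι => blk q.1.2) F₂s (fun a a' => cFb * α₁ * Real.exp (-(δ₀ * g.dist a a'))) →
      -- (i) THEOREM 3.4 FOR `G′(U′U) := G′(U)(I − V′(A)G′(U))⁻¹` ((3.64)): two-sided inverse and the four (3.42) entries in the printed kernel form
      (Δp - conj b (vPrimeConc T U g.eta A blk kQ kF sQ sF cfun)) * (gPrimeExtEnd Gp (conj b (vPrimeConc T U g.eta A blk kQ kF sQ sF cfun) * Gp)) = 1 ∧
      (gPrimeExtEnd Gp (conj b (vPrimeConc T U g.eta A blk kQ kF sQ sF cfun) * Gp)) * (Δp - conj b (vPrimeConc T U g.eta A blk kQ kF sQ sF cfun)) = 1 ∧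
      HasKernelBound (g := toB6 g Rr H) (fun p : S × ι => blk p.1) v c (gPrimeExtEnd Gp (conj b (vPrimeConc T U g.eta A blk kQ kF sQ sF cfun) * Gp))
        (fun a a' => B * g.len a ^ 2 * Real.exp (-(4 / 5 * δ₀ * g.dist a a'))) ∧
      (∀ k : κ ⊕ κ, HasKernelBound (g := toB6 g Rr H) (fun p : S × ι => blk p.1) v c (conj b (diffLetter T U ((g.eta : ℂ)⁻¹) k) * (gPrimeExtEnd Gp (conj b (vPrimeConc T U g.eta A blk kQ kF sQ sF cfun) * Gp)))
        (fun a a' => B * g.len a * Real.exp (-(4 / 5 * δ₀ * g.dist a a')))) ∧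
      (∀ l : κ ⊕ κ, HasKernelBound (g := toB6 g Rr H) (fun p : S × ι => blk p.1) v c ((gPrimeExtEnd Gp (conj b (vPrimeConc T U g.eta A blk kQ kF sQ sF cfun) * Gp)) * conj b (diffLetter T U ((g.eta : ℂ)⁻¹) l))
        (fun a a' => B * g.len a * Real.exp (-(4 / 5 * δ₀ * g.dist a a')))) ∧
      (∀ k l : κ ⊕ κ, HasKernelBound (g := toB6 g Rr H) (fun p : S × ι => blk p.1) v c (conj b (diffLetter T U ((g.eta : ℂ)⁻¹) k) * (gPrimeExtEnd Gp (conj b (vPrimeConc T U g.eta A blk kQ kF sQ sF cfun) * Gp)) * conj b (diffLetter T U ((g.eta : ℂ)⁻¹) l))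
        (fun a a' => B * Real.exp (-(4 / 5 * δ₀ * g.dist a a')))) ∧
    ∃ (Tinv : Module.End ℝ (g.Site → ℝ)) (GExt : Module.End ℝ ((κ × S) × ι → ℝ)),
      -- (ii) THEOREM 3.4 FOR `(Q′G′²Q′*)⁻¹(U′U)`: two-sided inverse with the printed kernel bound (3.48)
      Tinv * (Qc' ∘ₗ ((gPrimeExtEnd Gp (conj b (vPrimeConc T U g.eta A blk kQ kF sQ sF cfun) * Gp)) * (gPrimeExtEnd Gp (conj b (vPrimeConc T U g.eta A blk kQ kF sQ sF cfun) * Gp))) ∘ₗ Qcs') = 1 ∧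
      (Qc' ∘ₗ ((gPrimeExtEnd Gp (conj b (vPrimeConc T U g.eta A blk kQ kF sQ sF cfun) * Gp)) * (gPrimeExtEnd Gp (conj b (vPrimeConc T U g.eta A blk kQ kF sQ sF cfun) * Gp))) ∘ₗ Qcs') * Tinv = 1 ∧
      (∀ y y' : g.Site, |B9Thm34Inv.ker (B9Thm34Inv.vol g d) Tinv y y'| ≤
        B * g.len y ^ (-(4 : ℝ)) * g.len y' ^ (-(d : ℝ)) * Real.exp (-(9 / 25 * δ₀ * g.dist y y'))) ∧
      -- (ii′) THEOREM 3.4 FOR `R(U′U)`: (3.49) for `P(U′U) = I − R(U′U)` built with THIS `C⁻¹(U′U)`, in the printed kernel form (FILE 30)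
      HasKernelBound (g := toB6 g Rr H) (fun p : S × ι => blk p.1) v c (B9Eq360Vprime.pOp (gPrimeExtEnd Gp (conj b (vPrimeConc T U g.eta A blk kQ kF sQ sF cfun) * Gp)) (Qcs' ∘ₗ secRes rep) (secConj rep Tinv) (secExt rep ∘ₗ Qc'))
        (fun a a' => B * Real.exp (-(1 / 5 * δ₀ * g.dist a a'))) ∧
      (∀ k : κ ⊕ κ, HasKernelBound (g := toB6 g Rr H) (fun p : S × ι => blk p.1) v c (conj b (diffLetter T U ((g.eta : ℂ)⁻¹) k) * (B9Eq360Vprime.pOp (gPrimeExtEnd Gp (conj b (vPrimeConc T U g.eta A blk kQ kF sQ sF cfun) * Gp)) (Qcs' ∘ₗ secRes rep) (secConj rep Tinv) (secExt rep ∘ₗ Qc')))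
        (fun a a' => B * (g.len a)⁻¹ * Real.exp (-(1 / 5 * δ₀ * g.dist a a')))) ∧
      (∀ l : κ ⊕ κ, HasKernelBound (g := toB6 g Rr H) (fun p : S × ι => blk p.1) v c ((B9Eq360Vprime.pOp (gPrimeExtEnd Gp (conj b (vPrimeConc T U g.eta A blk kQ kF sQ sF cfun) * Gp)) (Qcs' ∘ₗ secRes rep) (secConj rep Tinv) (secExt rep ∘ₗ Qc')) * conj b (diffLetter T U ((g.eta : ℂ)⁻¹) l))
        (fun a a' => B * (g.len a)⁻¹ * Real.exp (-(1 / 5 * δ₀ * g.dist a a')))) ∧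
      (∀ k l : κ ⊕ κ, HasKernelBound (g := toB6 g Rr H) (fun p : S × ι => blk p.1) v c (conj b (diffLetter T U ((g.eta : ℂ)⁻¹) k) * (B9Eq360Vprime.pOp (gPrimeExtEnd Gp (conj b (vPrimeConc T U g.eta A blk kQ kF sQ sF cfun) * Gp)) (Qcs' ∘ₗ secRes rep) (secConj rep Tinv) (secExt rep ∘ₗ Qc')) * conj b (diffLetter T U ((g.eta : ℂ)⁻¹) l))
        (fun a a' => B * (g.len a ^ 2)⁻¹ * Real.exp (-(1 / 5 * δ₀ * g.dist a a')))) ∧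
      -- (iii) THEOREM 3.4 FOR `G(U′U)`: two-sided inverse of the concrete `Δ_a(U′U)` and the four (3.42) entries in the printed kernel form (FILE 25)
      deltaA (conj b (lapDDLetter T ((g.eta : ℂ)⁻¹) (prodCfg U g.eta A)))
          (conj b (dPrimeLetter T (prodCfg U g.eta A) g.eta))
          (conjHom b (gradLin T ((g.eta : ℂ)⁻¹) (prodCfg U g.eta A)) ∘ₗ (1 - ((Gp ∘ₗ Qcs ∘ₗ Linv ∘ₗ Qc ∘ₗ Gp) + (B9Eq360Vprime.pPrime Gp (gPrimeExtEnd Gp (conj b (vPrimeConc T U g.eta A blk kQ kF sQ sF cfun) * Gp)) (Qcs ∘ₗ secRes rep) (Qcs' ∘ₗ secRes rep) (secConj rep Linv) (secConj rep Tinv) (secExt rep ∘ₗ Qc) (secExt rep ∘ₗ Qc'))))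
            ∘ₗ conjHom b (divLin T ((g.eta : ℂ)⁻¹) (prodCfg U g.eta A))) Qs' a Q' * GExt = 1 ∧
      GExt *
      deltaA (conj b (lapDDLetter T ((g.eta : ℂ)⁻¹) (prodCfg U g.eta A)))
          (conj b (dPrimeLetter T (prodCfg U g.eta A) g.eta))
          (conjHom b (gradLin T ((g.eta : ℂ)⁻¹) (prodCfg U g.eta A)) ∘ₗ (1 - ((Gp ∘ₗ Qcs ∘ₗ Linv ∘ₗ Qc ∘ₗ Gp) + (B9Eq360Vprime.pPrime Gp (gPrimeExtEnd Gp (conj b (vPrimeConc T U g.eta A blk kQ kF sQ sF cfun) * Gp)) (Qcs ∘ₗ secRes rep) (Qcs' ∘ₗ secRes rep) (secConj rep Linv) (secConj rep Tinv) (secExt rep ∘ₗ Qc) (secExt rep ∘ₗ Qc'))))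
            ∘ₗ conjHom b (divLin T ((g.eta : ℂ)⁻¹) (prodCfg U g.eta A))) Qs' a Q' = 1 ∧
      HasKernelBound (g := toB6 g Rr H) (fun q : (κ × S) × ι => blk q.1.2) v c GExt
        (fun a a' => B * g.len a ^ 2 * Real.exp (-(1 / 10 * δ₀ * g.dist a a'))) ∧
      (∀ k : κ ⊕ κ, HasKernelBound (g := toB6 g Rr H) (fun q : (κ × S) × ι => blk q.1.2) v c
        (conj b (diffLetter (bT T) (bU U) ((g.eta : ℂ)⁻¹) k) * GExt)
        (fun a a' => B * g.len a * Real.exp (-(1 / 10 * δ₀ * g.dist a a')))) ∧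
      (∀ l : κ ⊕ κ, HasKernelBound (g := toB6 g Rr H) (fun q : (κ × S) × ι => blk q.1.2) v c
        (GExt * conj b (diffLetter (bT T) (bU U) ((g.eta : ℂ)⁻¹) l))
        (fun a a' => B * g.len a * Real.exp (-(1 / 10 * δ₀ * g.dist a a')))) ∧
      (∀ k l : κ ⊕ κ, HasKernelBound (g := toB6 g Rr H) (fun q : (κ × S) × ι => blk q.1.2) v c
        (conj b (diffLetter (bT T) (bU U) ((g.eta : ℂ)⁻¹) k) * GExt * conj b (diffLetter (bT T) (bU U) ((g.eta : ℂ)⁻¹) l))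
        (fun a a' => B * Real.exp (-(1 / 10 * δ₀ * g.dist a a')))) := by
  classical
  obtain ⟨a₁, ha₁, B₁', hB₁', HA⟩ := thm34_all_uniform b κ d δ₀ B₀ κQ BG B₁ cF Cq a₀ C₀ d₀ M₂ κQb cFb abar Λf hB₀ hκQ hBG hB₁ hcF hCq ha₀ hC₀ hM₂
    hδ₀ hκQb hcFb habar hΛf hrepr
  obtain ⟨a₂, ha₂, B₂, hB₂, HB⟩ := thm34_Gp_kernel_uniform b κ d δ₀ BG Cq a₀ d₀ M₂ Λf hBG hCq ha₀ hM₂ hδ₀ hΛf hrepr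
  obtain ⟨a₃, ha₃, B₃, hB₃, HC⟩ := thm34_P_kernel_uniform b κ d δ₀ κQ BG B₁ cF Cq a₀ d₀ M₂ Λf hκQ hBG hB₁ hcF hCq ha₀ hM₂ hδ₀ hΛf hrepr
  refine ⟨min (min a₁ a₂) a₃, lt_min (lt_min ha₁ ha₂) ha₃, B₁' + B₂ + B₃, add_nonneg (add_nonneg hB₁' hB₂) hB₃, ?_⟩
  -- NOW the lattice, the background, the data, the Theorems-for-`U` inputs (block and kernel members); then `α₁`, `A` and the `A`-letters
  intro S _ _ T U g _ _ _ Rr H blk kQ sQ cfun w hdnn htri hrefl hsym hlen hlenη hη hL h261 hST hT hU1 h35 hd₀B hd₀F hd₀FB hd₀st hd₀loc hd₀0 hw hcard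
    hkQ hsQ hcfun Gp h342_1 h342_2 h342_3 Δp hΔpGp hGpΔp rep hrep Qc Qcs Linv hQc hQcs hLinv h348 G Qs Q a hQb hQsb ha324 hΔG hGΔ hG hDG hGD v hv c
    hc hGk hDGk hGDk hDGDk hGpk hDGpk hGpDk hDGpDk α₁ hα₁0 hα₁1 A kF sF hkF hsF h337B h337F h337B' h337Bτ h337FB hA hAτB hAτF hAFB hAst hAloc hdAst
    Qc' Fc Qcs' Fcs h357 h357s hFc hFcs P₂ Qs' Q' F₂ F₂s h380 h380s hP₂def hF₂ hF₂s
  replace HA := HA T U blk kQ sQ cfun w hdnn htri hrefl hsym hlen hlenη hη hL h261 hST hT hU1 h35 hd₀B hd₀F hd₀FB hd₀st hd₀loc hd₀0 hw hcard hkQ hsQ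
    hcfun h342_1 h342_2 h342_3 hΔpGp hGpΔp rep hrep hQc hQcs hLinv h348 hQb hQsb ha324 hΔG hGΔ hG hDG hGD hv hc hGk hDGk hGDk hDGDk
  replace HB := HB T U blk kQ sQ cfun w hdnn htri hrefl hsym hlen hlenη hη h261 hST hU1 hd₀B hd₀F hd₀0 hw hcard hkQ hsQ hcfun hΔpGp hGpΔp h342_1
    h342_2 h342_3 hv hc hGpk hDGpk hGpDk hDGpDk
  replace HC := HC T U blk kQ sQ cfun w hdnn htri hrefl hsym hlen hlenη hη h261 hST hU1 hd₀B hd₀F hd₀0 hw hcard hkQ hsQ hcfun h342_1 h342_2 h342_3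
    rep hrep hQc hQcs hLinv h348 hΔpGp hGpΔp hv hc hGpk hDGpk hGpDk hDGpDk
  have hα₁a : α₁ ≤ a₁ := hα₁1.trans ((min_le_left _ _).trans (min_le_left _ _))
  have hα₁b : α₁ ≤ a₂ := hα₁1.trans ((min_le_left _ _).trans (min_le_right _ _))
  have hα₁c : α₁ ≤ a₃ := hα₁1.trans (min_le_right _ _)
  obtain ⟨i1, i2, -, -, Tinv, GExt, e1, e2, hTk, -, -, -, -, -, -, -, -, e3, e4, -, -, k1, k2, k3, k4⟩ := HA α₁ hα₁0 hα₁a A kF sF hkF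
    hsF h337B h337F h337B' h337Bτ h337FB hA hAτB hAτF hAFB hAst hAloc hdAst h357 h357s hFc hFcs h380 h380s hP₂def hF₂ hF₂s
  obtain ⟨-, -, q1, q2, q3, q4⟩ := HB α₁ hα₁0 hα₁b A kF sF hkF hsF h337B h337F h337Bτ hA hAτB
  obtain ⟨Tinv₃, g1, -, p1, p2, p3, p4⟩ := HC α₁ hα₁0 hα₁c A kF sF hkF hsF h337B h337F h337Bτ hA hAτB h357 h357s hFc hFcs
  -- the two `C⁻¹(U′U)` agree (uniqueness of the two-sided inverse)
  have hT3 : Tinv₃ = Tinv := left_inv_eq_right_inv g1 e2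
  rw [hT3] at p1 p2 p3 p4
  -- one constant `B`
  have hle1 : B₁' ≤ B₁' + B₂ + B₃ := by linarith only [hB₂, hB₃]
  have hle2 : B₂ ≤ B₁' + B₂ + B₃ := by linarith only [hB₁', hB₃]
  have hle3 : B₃ ≤ B₁' + B₂ + B₃ := by linarith only [hB₁', hB₂]
  have hw1i : ∀ a : g.Site, 0 ≤ (g.len a)⁻¹ := fun a => inv_nonneg.mpr (hlen a).le
  have hw2i : ∀ a : g.Site, 0 ≤ (g.len a ^ 2)⁻¹ := fun a => inv_nonneg.mpr (sq_nonneg _)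
  have hw1 : ∀ a : g.Site, 0 ≤ g.len a := fun a => (hlen a).le
  have hw2 : ∀ a : g.Site, 0 ≤ g.len a ^ 2 := fun a => sq_nonneg _
  refine ⟨i1, i2, ?_, fun k => ?_, fun l => ?_, fun k l => ?_, Tinv, GExt, e1, e2, fun y y' => ?_, ?_, fun k => ?_, fun l => ?_,
    fun k l => ?_, e3, e4, ?_, fun k => ?_, fun l => ?_, fun k l => ?_⟩
  · exact hasKernelBound_mono (g := toB6 g Rr H) _ hv q1 fun a a' =>
      mul_le_mul_of_nonneg_right (mul_le_mul_of_nonneg_right hle2 (hw2 a)) (Real.exp_nonneg _)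
  · exact hasKernelBound_mono (g := toB6 g Rr H) _ hv (q2 k) fun a a' =>
      mul_le_mul_of_nonneg_right (mul_le_mul_of_nonneg_right hle2 (hw1 a)) (Real.exp_nonneg _)
  · exact hasKernelBound_mono (g := toB6 g Rr H) _ hv (q3 l) fun a a' =>
      mul_le_mul_of_nonneg_right (mul_le_mul_of_nonneg_right hle2 (hw1 a)) (Real.exp_nonneg _)
  · exact hasKernelBound_mono (g := toB6 g Rr H) _ hv (q4 k l) fun a a' => mul_le_mul_of_nonneg_right hle2 (Real.exp_nonneg _)
  · exact (hTk y y').trans (mul_le_mul_of_nonneg_right (mul_le_mul_of_nonneg_right (mul_le_mul_of_nonneg_right hle1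
      (Real.rpow_nonneg (hlen y).le _)) (Real.rpow_nonneg (hlen y').le _)) (Real.exp_nonneg _))
  · exact hasKernelBound_mono (g := toB6 g Rr H) _ hv p1 fun a a' => mul_le_mul_of_nonneg_right hle3 (Real.exp_nonneg _)
  · exact hasKernelBound_mono (g := toB6 g Rr H) _ hv (p2 k) fun a a' =>
      mul_le_mul_of_nonneg_right (mul_le_mul_of_nonneg_right hle3 (hw1i a)) (Real.exp_nonneg _)
  · exact hasKernelBound_mono (g := toB6 g Rr H) _ hv (p3 l) fun a a' =>
      mul_le_mul_of_nonneg_right (mul_le_mul_of_nonneg_right hle3 (hw1i a)) (Real.exp_nonneg _)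
  · exact hasKernelBound_mono (g := toB6 g Rr H) _ hv (p4 k l) fun a a' =>
      mul_le_mul_of_nonneg_right (mul_le_mul_of_nonneg_right hle3 (hw2i a)) (Real.exp_nonneg _)
  · exact hasKernelBound_mono (g := toB6 g Rr H) _ hv k1 fun a a' =>
      mul_le_mul_of_nonneg_right (mul_le_mul_of_nonneg_right hle1 (hw2 a)) (Real.exp_nonneg _)
  · exact hasKernelBound_mono (g := toB6 g Rr H) _ hv (k2 k) fun a a' =>
      mul_le_mul_of_nonneg_right (mul_le_mul_of_nonneg_right hle1 (hw1 a)) (Real.exp_nonneg _)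
  · exact hasKernelBound_mono (g := toB6 g Rr H) _ hv (k3 l) fun a a' =>
      mul_le_mul_of_nonneg_right (mul_le_mul_of_nonneg_right hle1 (hw1 a)) (Real.exp_nonneg _)
  · exact hasKernelBound_mono (g := toB6 g Rr H) _ hv (k4 k l) fun a a' => mul_le_mul_of_nonneg_right hle1 (Real.exp_nonneg _)

set_option maxHeartbeats 1600000 in
/-- **THEOREM 3.4 p. 400 — EVERY SUP/KERNEL MEMBER NAMED ON pp. 400–403, PRINTED KERNEL FORM, ONE STATEMENT, THE CONSTANTS CHOSEN BEFORE THE LATTICE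
(THE UNIFORM ONE-NAME OFFER IN KERNEL FORM)**: `thm34_all_kernel_uniform` (i)–(iii) PLUS, with the SAME `C⁻¹(U′U)` and the same `a₁`, `B`: (iv) p. 403
«Moreover we have P(U′U) = P(U) + P′(A), [|P′(A;x,x′)|, |(DP′(A))_μ(x,x′)|, |(P′(A)D*)_ν(x,x′)|, |(DP′(A)D*)_{μν}(x,x′)|] ≦ O(1)α₁[1, (Lʲη)⁻¹, (Lʲη)⁻¹,
(Lʲη)⁻²](L^{j′}η)^{−d}e^{−(1/2)δ₀d(y,y′)} (3.68)» — the four entries of `P′(A)` as kernel bounds `Bα₁[1, (Lʲη)⁻¹, (Lʲη)⁻¹, (Lʲη)⁻²]e^{−(δ₀/5)d}v(y′)⁻¹`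
(FILE 52 `thm34_pPrime_kernel_uniform`, its `C⁻¹(U′U)` identified with (ii)'s by `left_inv_eq_right_inv`); (v) p. 403 L7–9 «the remainders
G′(U)V′(A)G′(U′U) and G′(U′U)V′(A)G′(U) in (3.65) … satisfy Theorem 3.1 with the additional small factor O(1)α₁» — both `= G′(U′U) − G′(U)`, four (3.42)
kernel entries `Bα₁[(Lʲη)², Lʲη, Lʲη, 1]e^{−(4δ₀/5)d}v⁻¹` (FILE 50 `remainder365_kernel_uniform`); p. 399 «the constants … do not depend on the sequence
{Ω_j}»: `∃ a₁ > 0 ∃ B ≧ 0 ∀ (lattice, background, data, Theorems 3.1–3.3 for U) ∀ α₁ ≦ a₁ ∀ A …` — FILE 31 v1.1 `thm34_all_kernel_final'` verbatim,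
re-quantified; `a₁ = min` of three, `B = B₅₃ + B₅₂ + B₅₀`.
[cite: Balaban1985BackgroundPropagators, Thm 3.4 p.400 + p.399 + (3.68) p.403 + p.403 L7–9 + (3.65) p.402 + (3.49) p.399 + Thm 3.1 (3.42) p.397 + Thm 3.2 (3.48) p.398 + Thm 3.3 p.399 + (3.82)–(3.86) p.407 + (3.37) p.396; Balaban1984PropagatorsII, Lemma 2.1 p.234 + (2.51)–(2.55) p.232 + (2.66) p.234] -/
theorem thm34_all_kernel_uniform' [DecidableEq ι] (d : ℕ)
    (δ₀ B₀ κQ BG B₁ cF Cq a₀ C₀ d₀ M₂ κQb cFb abar : ℝ) (Λf : ℝ → ℝ)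
    (hB₀ : 0 ≤ B₀) (hκQ : 0 < κQ) (hBG : 0 < BG) (hB₁ : 0 < B₁) (hcF : 0 < cF) (hCq : 0 ≤ Cq) (ha₀ : 0 ≤ a₀) (hC₀ : 0 ≤ C₀)
    (hM₂ : 0 ≤ M₂) (hδ₀ : 0 < δ₀) (hκQb : 0 ≤ κQb) (hcFb : 0 ≤ cFb) (habar : 0 ≤ abar) (hΛf : ∀ α : ℝ, 0 < α → 1 ≤ Λf α)
    (hrepr : ∀ (v : 𝔸) (i : ι), |b.repr v i| ≤ M₂ * ‖v‖) :
    ∃ a₁ : ℝ, 0 < a₁ ∧ ∃ B : ℝ, 0 ≤ B ∧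
    ∀ {S : Type} [Fintype S] [DecidableEq S] (T : κ → Equiv.Perm S) (U : κ → S → 𝔸ˣ)
      {g : B9.Geometry} [Fintype g.Site] [DecidableEq g.Site] [Nonempty g.Site] {Rr : ℝ} {H : Prop} (blk : S → g.Site)
      (kQ : g.Site → S → 𝔸 →L[ℝ] 𝔸) (sQ : S → 𝔸 →L[ℝ] 𝔸) (cfun w : g.Site → ℝ)
    -- the multiscale geometry 𝔅 (p. 393, [4] (2.1)–(2.4)) and its axioms
    (hdnn : ∀ a a' : g.Site, 0 ≤ g.dist a a') (htri : Triangle254 (toB6 g Rr H)) (hrefl : ∀ y : g.Site, g.dist y y = 0)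
    (hsym : ∀ y y' : g.Site, g.dist y y' = g.dist y' y) (hlen : ∀ y : g.Site, 0 < g.len y) (hlenη : ∀ y : g.Site, g.eta ≤ g.len y)
    (hη : 0 < g.eta) (hL : 1 ≤ g.L)
    -- [4] Lemma 2.1 (2.61) at the rate `δ₀`, «for every 0 < α < 1»
    (h261 : ∀ α : ℝ, 0 < α → α < 1 → Ineq261 d (toB6 g Rr H) δ₀ α)
    -- p. 398: «Using Lemma 2.1 in [4] we may replace the factor (Lʲη)^α by (Lʲη)^β(L^{j′}η)^γ with β + γ = α» — for every exponent, one
    -- constant `Λ(α) ≧ 1` for the six weights `(Lʲη)^{1,2,−1,−2,−4}` (natural and real powers)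
      (hST : ∀ α : ℝ, 0 < α → ScaleTransfer g δ₀ α (Λf α) (fun a => g.len a) ∧ ScaleTransfer g δ₀ α (Λf α) (fun a => g.len a ^ 2) ∧
        ScaleTransfer g δ₀ α (Λf α) (fun a => (g.len a)⁻¹) ∧ ScaleTransfer g δ₀ α (Λf α) (fun a => (g.len a ^ 2)⁻¹) ∧
        ScaleTransfer g δ₀ α (Λf α) (fun a => (g.len a ^ 4)⁻¹) ∧ ScaleTransfer g δ₀ α (Λf α) (fun y => g.len y ^ (-(4 : ℝ))))
    -- real coordinates of `𝔸`, commuting translations, unitary-type background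
    (hT : ∀ (μ ν : κ) (x : S), T μ (T ν x) = T ν (T μ x))
    (hU1 : ∀ m z, ‖((U m z : 𝔸ˣ) : 𝔸)‖ ≤ 1 ∧ ‖(((U m z)⁻¹ : 𝔸ˣ) : 𝔸)‖ ≤ 1)
    -- (3.35) on the plaquettes through each bond, at that bond's block scale; stencil geometry at range `d₀`
    (h35 : ∀ μ x m n y, Through T μ x m n y → ‖(plaqU T U m n y : 𝔸) - 1‖ ≤ C₀ * ((g.L ^ g.scale (blk x))⁻¹) ^ 2)
    (hd₀B : ∀ μ x, g.dist (blk x) (blk ((T μ).symm x)) ≤ d₀) (hd₀F : ∀ μ x, g.dist (blk x) (blk (T μ x)) ≤ d₀)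
    (hd₀FB : ∀ μ ν x, g.dist (blk x) (blk ((T ν).symm (T μ x))) ≤ d₀)
    (hd₀st : ∀ μ x (q : κ × S), q ∈ stBonds T μ x → g.dist (blk x) (blk q.2) ≤ d₀)
    (hd₀loc : ∀ μ x (q : κ × S), q ∈ B9Eq375Locality.locBondsA' T μ x → g.dist (blk x) (blk q.2) ≤ d₀)
    (hd₀0 : ∀ y : g.Site, g.dist y y ≤ d₀)
    -- the `A`-independent data of the concrete `V′(A)` of (3.60): (3.19) kernels/multipliers and the `a`-weights of (3.24)
    (hw : ∀ y, 0 ≤ w y) (hcard : ∀ y, ((B9Eq360Vprime.block blk y).card : ℝ) * w y ≤ 1)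
    (hkQ : ∀ y x, blk x = y → ‖kQ y x‖ ≤ w y) (hsQ : ∀ x, ‖sQ x‖ ≤ 1) (hcfun : ∀ y, |cfun y| ≤ a₀ * (g.len y ^ 2)⁻¹)
    -- THEOREM 3.1 for `G′(U)`: (3.42)₁,₂,₃ at the rate `δ₀`
    {Gp : Module.End ℝ (S × ι → ℝ)}
    (h342_1 : HasMajorant (g := toB6 g Rr H) (fun p : S × ι => blk p.1) Gp
      (fun a a' => BG * g.len a ^ 2 * Real.exp (-(δ₀ * g.dist a a'))))
    (h342_2 : ∀ k : κ ⊕ κ, HasMajorant (g := toB6 g Rr H) (fun p : S × ι => blk p.1)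
      (conj b (diffLetter T U ((g.eta : ℂ)⁻¹) k) * Gp) (fun a a' => BG * g.len a * Real.exp (-(δ₀ * g.dist a a'))))
    (h342_3 : ∀ k : κ ⊕ κ, HasMajorant (g := toB6 g Rr H) (fun p : S × ι => blk p.1)
      (Gp * conj b (diffLetter T U ((g.eta : ℂ)⁻¹) k)) (fun a a' => BG * g.len a * Real.exp (-(δ₀ * g.dist a a'))))
    -- (3.24): `G′(U) = (Δ′_a(U))⁻¹` for the letter `Δ′_a(U)`
    {Δp : Module.End ℝ (S × ι → ℝ)} (hΔpGp : Δp * Gp = 1) (hGpΔp : Gp * Δp = 1)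
    -- the (3.19) letters `Q′(U)`, `Q′*(U)` in their own typing with block-local two-space majorants, a section of the block map (FILE 17)
    (rep : g.Site → S × ι) (hrep : ∀ y : g.Site, blk (rep y).1 = y)
    {Qc : (S × ι → ℝ) →ₗ[ℝ] (g.Site → ℝ)} {Qcs : (g.Site → ℝ) →ₗ[ℝ] (S × ι → ℝ)} {Linv : Module.End ℝ (g.Site → ℝ)}
    (hQc : HasMajorantHom (g := toB6 g Rr H) (fun p : S × ι => blk p.1) (fun y : g.Site => y) Qc
      (fun a a' : g.Site => κQ * (if a = a' then (1 : ℝ) else 0)))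
    (hQcs : HasMajorantHom (g := toB6 g Rr H) (fun y : g.Site => y) (fun p : S × ι => blk p.1) Qcs
      (fun a a' : g.Site => κQ * (if a = a' then (1 : ℝ) else 0)))
    -- THEOREM 3.2 for `U`: (3.21) `C⁻¹ = (Q′G′²Q′*)⁻¹` exists (`hLinv`) with the KERNEL bound (3.48) at the rate `δ₀`
    (hLinv : (Qc ∘ₗ (Gp * Gp) ∘ₗ Qcs) * Linv = 1)
    (h348 : ∀ y y' : g.Site, |B9Thm34Inv.ker (B9Thm34Inv.vol g d) Linv y y'| ≤
      B₁ * g.len y ^ (-(4 : ℝ)) * g.len y' ^ (-(d : ℝ)) * Real.exp (-(δ₀ * g.dist y y')))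
    -- the (3.15) bond letters `Q(U)`, `Q*(U)` and the weight letter `a` of (3.24)/(3.26), with their majorants
    {G Qs Q a : Module.End ℝ ((κ × S) × ι → ℝ)}
    (hQb : HasMajorant (g := toB6 g Rr H) (fun q : (κ × S) × ι => blk q.1.2) Q (fun a a' => κQb * Real.exp (-(δ₀ * g.dist a a'))))
    (hQsb : HasMajorant (g := toB6 g Rr H) (fun q : (κ × S) × ι => blk q.1.2) Qs (fun a a' => κQb * Real.exp (-(δ₀ * g.dist a a'))))
    (ha324 : HasMajorant (g := toB6 g Rr H) (fun q : (κ × S) × ι => blk q.1.2) a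
      (fun a a' : g.Site => if a = a' then abar * (g.len a ^ 2)⁻¹ else 0))
    -- THEOREM 3.3 for `G(U)`: two-sided inverse of the concrete `Δ_a(U)` and its (3.42)-entries at the rate `δ₀`
    (hΔG : deltaA (conj b (lapDDLetter T ((g.eta : ℂ)⁻¹) U)) (conj b (dPrimeLetter T U g.eta))
      (conjHom b (gradLin T ((g.eta : ℂ)⁻¹) U) ∘ₗ (1 - (Gp ∘ₗ Qcs ∘ₗ Linv ∘ₗ Qc ∘ₗ Gp)) ∘ₗ conjHom b (divLin T ((g.eta : ℂ)⁻¹) U)) Qs a Q * G = 1)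
    (hGΔ : G * deltaA (conj b (lapDDLetter T ((g.eta : ℂ)⁻¹) U)) (conj b (dPrimeLetter T U g.eta))
      (conjHom b (gradLin T ((g.eta : ℂ)⁻¹) U) ∘ₗ (1 - (Gp ∘ₗ Qcs ∘ₗ Linv ∘ₗ Qc ∘ₗ Gp)) ∘ₗ conjHom b (divLin T ((g.eta : ℂ)⁻¹) U)) Qs a Q = 1)
    (hG : HasMajorant (g := toB6 g Rr H) (fun q : (κ × S) × ι => blk q.1.2) G
      (fun a a' => B₀ * g.len a ^ 2 * Real.exp (-(δ₀ * g.dist a a'))))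
    (hDG : ∀ k : κ ⊕ κ, HasMajorant (g := toB6 g Rr H) (fun q : (κ × S) × ι => blk q.1.2)
      (conj b (diffLetter (bT T) (bU U) ((g.eta : ℂ)⁻¹) k) * G) (fun a a' => B₀ * g.len a * Real.exp (-(δ₀ * g.dist a a'))))
    (hGD : ∀ k : κ ⊕ κ, HasMajorant (g := toB6 g Rr H) (fun q : (κ × S) × ι => blk q.1.2)
      (G * conj b (diffLetter (bT T) (bU U) ((g.eta : ℂ)⁻¹) k)) (fun a a' => B₀ * g.len a * Real.exp (-(δ₀ * g.dist a a'))))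
    -- NEW (kernel form): Theorem 3.3's (3.42)₁,₂,₃,₄ for `G(U)` as PRINTED KERNEL BOUNDS (pairing weight `c = η^d`, volume weight `v(y′) = (L^j′ η)^d`)
    {v : g.Site → ℝ} (hv : ∀ y, 0 < v y) {c : ℝ} (hc : 0 < c)
    (hGk : HasKernelBound (g := toB6 g Rr H) (fun q : (κ × S) × ι => blk q.1.2) v c G
      (fun a a' => B₀ * g.len a ^ 2 * Real.exp (-(δ₀ * g.dist a a'))))
    (hDGk : ∀ k : κ ⊕ κ, HasKernelBound (g := toB6 g Rr H) (fun q : (κ × S) × ι => blk q.1.2) v c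
      (conj b (diffLetter (bT T) (bU U) ((g.eta : ℂ)⁻¹) k) * G) (fun a a' => B₀ * g.len a * Real.exp (-(δ₀ * g.dist a a'))))
    (hGDk : ∀ l : κ ⊕ κ, HasKernelBound (g := toB6 g Rr H) (fun q : (κ × S) × ι => blk q.1.2) v c
      (G * conj b (diffLetter (bT T) (bU U) ((g.eta : ℂ)⁻¹) l)) (fun a a' => B₀ * g.len a * Real.exp (-(δ₀ * g.dist a a'))))
    (hDGDk : ∀ k l : κ ⊕ κ, HasKernelBound (g := toB6 g Rr H) (fun q : (κ × S) × ι => blk q.1.2) v c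
      (conj b (diffLetter (bT T) (bU U) ((g.eta : ℂ)⁻¹) k) * G * conj b (diffLetter (bT T) (bU U) ((g.eta : ℂ)⁻¹) l)) (fun a a' => B₀ * Real.exp (-(δ₀ * g.dist a a'))))
    -- NEW (kernel form, FILES 29/30): Theorem 3.1's (3.42)₁,₂,₃,₄ for `G′(U)` as PRINTED KERNEL BOUNDS on the sites (same pairing `c`, volume `v`)
    (hGpk : HasKernelBound (g := toB6 g Rr H) (fun p : S × ι => blk p.1) v c Gp
      (fun a a' => BG * g.len a ^ 2 * Real.exp (-(δ₀ * g.dist a a'))))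
    (hDGpk : ∀ k : κ ⊕ κ, HasKernelBound (g := toB6 g Rr H) (fun p : S × ι => blk p.1) v c
      (conj b (diffLetter T U ((g.eta : ℂ)⁻¹) k) * Gp) (fun a a' => BG * g.len a * Real.exp (-(δ₀ * g.dist a a'))))
    (hGpDk : ∀ l : κ ⊕ κ, HasKernelBound (g := toB6 g Rr H) (fun p : S × ι => blk p.1) v c
      (Gp * conj b (diffLetter T U ((g.eta : ℂ)⁻¹) l)) (fun a a' => BG * g.len a * Real.exp (-(δ₀ * g.dist a a'))))
    (hDGpDk : ∀ k l : κ ⊕ κ, HasKernelBound (g := toB6 g Rr H) (fun p : S × ι => blk p.1) v c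
      (conj b (diffLetter T U ((g.eta : ℂ)⁻¹) k) * Gp * conj b (diffLetter T U ((g.eta : ℂ)⁻¹) l)) (fun a a' => BG * Real.exp (-(δ₀ * g.dist a a')))),
    ∀ (α₁ : ℝ), 0 ≤ α₁ → α₁ ≤ a₁ →
    -- the exponent field `A` in the domain (3.37), read blockwise in the shapes of FILES 1–19, and the `A`-dependent (3.59) data `kF`, `sF`
    ∀ (A : κ → S → 𝔸) (kF : g.Site → S → 𝔸 →L[ℝ] 𝔸) (sF : S → 𝔸 →L[ℝ] 𝔸),
      (∀ y x, blk x = y → ‖kF y x‖ ≤ Cq * α₁ * w y) → (∀ x, ‖sF x‖ ≤ Cq * α₁) →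
      (∀ ν k x, ‖((g.eta : ℂ)⁻¹) • covDstar T U ν (A k) x‖ ≤ α₁ * (g.len (blk x) ^ 2)⁻¹) →
      (∀ μ ν x, ‖((g.eta : ℂ)⁻¹) • covD T U μ (A ν) x‖ ≤ α₁ * (g.len (blk x) ^ 2)⁻¹) →
      (∀ μ ν x, ‖((g.eta : ℂ)⁻¹) • covDstar T U ν (A ν) (T μ x)‖ ≤ α₁ * (g.len (blk x) ^ 2)⁻¹) →
      (∀ μ x, ‖((g.eta : ℂ)⁻¹) • covDstar T U μ (tauB T U μ (A μ)) x‖ ≤ α₁ * (g.len (blk x) ^ 2)⁻¹) →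
      (∀ μ ν k x, ‖((g.eta : ℂ)⁻¹) • covD T U μ (A k) ((T ν).symm x)‖ ≤ α₁ * (g.len (blk x) ^ 2)⁻¹) →
      (∀ k x, ‖A k x‖ ≤ α₁ * (g.len (blk x))⁻¹) → (∀ ν k x, ‖tauB T U ν (A k) x‖ ≤ α₁ * (g.len (blk x))⁻¹) →
      (∀ μ k x, ‖tauF T U μ (A k) x‖ ≤ α₁ * (g.len (blk x))⁻¹) →
      (∀ k μ ν x, ‖A k ((T ν).symm (T μ x))‖ ≤ α₁ * (g.len (blk x))⁻¹) →
      (∀ μ x m z, (m, z) ∈ stBonds T μ x → ‖A m z‖ ≤ α₁ * (g.len (blk x))⁻¹) →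
      (∀ μ x m z, (m, z) ∈ B9Eq375Locality.locBondsA T μ x → ‖A m z‖ ≤ α₁ * (g.len (blk x))⁻¹) →
      (∀ μ x m n y, Through T μ x m n y →
        ‖covD T U m (A n) y‖ ≤ g.eta * (α₁ * ((g.len (blk x))⁻¹) ^ 2) ∧ ‖covD T U n (A m) y‖ ≤ g.eta * (α₁ * ((g.len (blk x))⁻¹) ^ 2)) →
    -- the (3.57)/(3.59) letters `F′₂(A)`, `F′₂*(A)` (block-local, size `c_F α₁`)
    ∀ {Qc' Fc : (S × ι → ℝ) →ₗ[ℝ] (g.Site → ℝ)} {Qcs' Fcs : (g.Site → ℝ) →ₗ[ℝ] (S × ι → ℝ)},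
      Qc' = Qc + Fc → Qcs' = Qcs + Fcs →
      HasMajorantHom (g := toB6 g Rr H) (fun p : S × ι => blk p.1) (fun y : g.Site => y) Fc
        (fun a a' : g.Site => cF * α₁ * (if a = a' then (1 : ℝ) else 0)) →
      HasMajorantHom (g := toB6 g Rr H) (fun y : g.Site => y) (fun p : S × ι => blk p.1) Fcs
        (fun a a' : g.Site => cF * α₁ * (if a = a' then (1 : ℝ) else 0)) →
    -- the (3.80)–(3.81) letters `F₂(A)`, `F₂*(A)` («|F₂(A)|, |F₂*(A)| ≦ O(1)α₁»), `P₂(A)` of (3.82)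
    ∀ {P₂ Qs' Q' F₂ F₂s : Module.End ℝ ((κ × S) × ι → ℝ)},
      Q' = Q + F₂ → Qs' = Qs + F₂s → P₂ = pTwo Qs Q F₂ F₂s a →
      HasMajorant (g := toB6 g Rr H) (fun q : (κ × S) × ι => blk q.1.2) F₂ (fun a a' => cFb * α₁ * Real.exp (-(δ₀ * g.dist a a'))) →
      HasMajorant (g := toB6 g Rr H) (fun q : (κ × S) × ι => blk q.1.2) F₂s (fun a a' => cFb * α₁ * Real.exp (-(δ₀ * g.dist a a'))) →
      -- (i) THEOREM 3.4 FOR `G′(U′U) := G′(U)(I − V′(A)G′(U))⁻¹` ((3.64)): two-sided inverse and the four (3.42) entries in the printed kernel form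
      (Δp - conj b (vPrimeConc T U g.eta A blk kQ kF sQ sF cfun)) * (gPrimeExtEnd Gp (conj b (vPrimeConc T U g.eta A blk kQ kF sQ sF cfun) * Gp)) = 1 ∧
      (gPrimeExtEnd Gp (conj b (vPrimeConc T U g.eta A blk kQ kF sQ sF cfun) * Gp)) * (Δp - conj b (vPrimeConc T U g.eta A blk kQ kF sQ sF cfun)) = 1 ∧
      HasKernelBound (g := toB6 g Rr H) (fun p : S × ι => blk p.1) v c (gPrimeExtEnd Gp (conj b (vPrimeConc T U g.eta A blk kQ kF sQ sF cfun) * Gp))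
        (fun a a' => B * g.len a ^ 2 * Real.exp (-(4 / 5 * δ₀ * g.dist a a'))) ∧
      (∀ k : κ ⊕ κ, HasKernelBound (g := toB6 g Rr H) (fun p : S × ι => blk p.1) v c (conj b (diffLetter T U ((g.eta : ℂ)⁻¹) k) * (gPrimeExtEnd Gp (conj b (vPrimeConc T U g.eta A blk kQ kF sQ sF cfun) * Gp)))
        (fun a a' => B * g.len a * Real.exp (-(4 / 5 * δ₀ * g.dist a a')))) ∧
      (∀ l : κ ⊕ κ, HasKernelBound (g := toB6 g Rr H) (fun p : S × ι => blk p.1) v c ((gPrimeExtEnd Gp (conj b (vPrimeConc T U g.eta A blk kQ kF sQ sF cfun) * Gp)) * conj b (diffLetter T U ((g.eta : ℂ)⁻¹) l))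
        (fun a a' => B * g.len a * Real.exp (-(4 / 5 * δ₀ * g.dist a a')))) ∧
      (∀ k l : κ ⊕ κ, HasKernelBound (g := toB6 g Rr H) (fun p : S × ι => blk p.1) v c (conj b (diffLetter T U ((g.eta : ℂ)⁻¹) k) * (gPrimeExtEnd Gp (conj b (vPrimeConc T U g.eta A blk kQ kF sQ sF cfun) * Gp)) * conj b (diffLetter T U ((g.eta : ℂ)⁻¹) l))
        (fun a a' => B * Real.exp (-(4 / 5 * δ₀ * g.dist a a')))) ∧
    ∃ (Tinv : Module.End ℝ (g.Site → ℝ)) (GExt : Module.End ℝ ((κ × S) × ι → ℝ)),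
      -- (ii) THEOREM 3.4 FOR `(Q′G′²Q′*)⁻¹(U′U)`: two-sided inverse with the printed kernel bound (3.48)
      Tinv * (Qc' ∘ₗ ((gPrimeExtEnd Gp (conj b (vPrimeConc T U g.eta A blk kQ kF sQ sF cfun) * Gp)) * (gPrimeExtEnd Gp (conj b (vPrimeConc T U g.eta A blk kQ kF sQ sF cfun) * Gp))) ∘ₗ Qcs') = 1 ∧
      (Qc' ∘ₗ ((gPrimeExtEnd Gp (conj b (vPrimeConc T U g.eta A blk kQ kF sQ sF cfun) * Gp)) * (gPrimeExtEnd Gp (conj b (vPrimeConc T U g.eta A blk kQ kF sQ sF cfun) * Gp))) ∘ₗ Qcs') * Tinv = 1 ∧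
      (∀ y y' : g.Site, |B9Thm34Inv.ker (B9Thm34Inv.vol g d) Tinv y y'| ≤
        B * g.len y ^ (-(4 : ℝ)) * g.len y' ^ (-(d : ℝ)) * Real.exp (-(9 / 25 * δ₀ * g.dist y y'))) ∧
      -- (ii′) THEOREM 3.4 FOR `R(U′U)`: (3.49) for `P(U′U) = I − R(U′U)` built with THIS `C⁻¹(U′U)`, in the printed kernel form (FILE 30)
      HasKernelBound (g := toB6 g Rr H) (fun p : S × ι => blk p.1) v c (B9Eq360Vprime.pOp (gPrimeExtEnd Gp (conj b (vPrimeConc T U g.eta A blk kQ kF sQ sF cfun) * Gp)) (Qcs' ∘ₗ secRes rep) (secConj rep Tinv) (secExt rep ∘ₗ Qc'))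
        (fun a a' => B * Real.exp (-(1 / 5 * δ₀ * g.dist a a'))) ∧
      (∀ k : κ ⊕ κ, HasKernelBound (g := toB6 g Rr H) (fun p : S × ι => blk p.1) v c (conj b (diffLetter T U ((g.eta : ℂ)⁻¹) k) * (B9Eq360Vprime.pOp (gPrimeExtEnd Gp (conj b (vPrimeConc T U g.eta A blk kQ kF sQ sF cfun) * Gp)) (Qcs' ∘ₗ secRes rep) (secConj rep Tinv) (secExt rep ∘ₗ Qc')))
        (fun a a' => B * (g.len a)⁻¹ * Real.exp (-(1 / 5 * δ₀ * g.dist a a')))) ∧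
      (∀ l : κ ⊕ κ, HasKernelBound (g := toB6 g Rr H) (fun p : S × ι => blk p.1) v c ((B9Eq360Vprime.pOp (gPrimeExtEnd Gp (conj b (vPrimeConc T U g.eta A blk kQ kF sQ sF cfun) * Gp)) (Qcs' ∘ₗ secRes rep) (secConj rep Tinv) (secExt rep ∘ₗ Qc')) * conj b (diffLetter T U ((g.eta : ℂ)⁻¹) l))
        (fun a a' => B * (g.len a)⁻¹ * Real.exp (-(1 / 5 * δ₀ * g.dist a a')))) ∧
      (∀ k l : κ ⊕ κ, HasKernelBound (g := toB6 g Rr H) (fun p : S × ι => blk p.1) v c (conj b (diffLetter T U ((g.eta : ℂ)⁻¹) k) * (B9Eq360Vprime.pOp (gPrimeExtEnd Gp (conj b (vPrimeConc T U g.eta A blk kQ kF sQ sF cfun) * Gp)) (Qcs' ∘ₗ secRes rep) (secConj rep Tinv) (secExt rep ∘ₗ Qc')) * conj b (diffLetter T U ((g.eta : ℂ)⁻¹) l))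
        (fun a a' => B * (g.len a ^ 2)⁻¹ * Real.exp (-(1 / 5 * δ₀ * g.dist a a')))) ∧
      -- (iii) THEOREM 3.4 FOR `G(U′U)`: two-sided inverse of the concrete `Δ_a(U′U)` and the four (3.42) entries in the printed kernel form (FILE 25)
      deltaA (conj b (lapDDLetter T ((g.eta : ℂ)⁻¹) (prodCfg U g.eta A)))
          (conj b (dPrimeLetter T (prodCfg U g.eta A) g.eta))
          (conjHom b (gradLin T ((g.eta : ℂ)⁻¹) (prodCfg U g.eta A)) ∘ₗ (1 - ((Gp ∘ₗ Qcs ∘ₗ Linv ∘ₗ Qc ∘ₗ Gp) + (B9Eq360Vprime.pPrime Gp (gPrimeExtEnd Gp (conj b (vPrimeConc T U g.eta A blk kQ kF sQ sF cfun) * Gp)) (Qcs ∘ₗ secRes rep) (Qcs' ∘ₗ secRes rep) (secConj rep Linv) (secConj rep Tinv) (secExt rep ∘ₗ Qc) (secExt rep ∘ₗ Qc'))))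
            ∘ₗ conjHom b (divLin T ((g.eta : ℂ)⁻¹) (prodCfg U g.eta A))) Qs' a Q' * GExt = 1 ∧
      GExt *
      deltaA (conj b (lapDDLetter T ((g.eta : ℂ)⁻¹) (prodCfg U g.eta A)))
          (conj b (dPrimeLetter T (prodCfg U g.eta A) g.eta))
          (conjHom b (gradLin T ((g.eta : ℂ)⁻¹) (prodCfg U g.eta A)) ∘ₗ (1 - ((Gp ∘ₗ Qcs ∘ₗ Linv ∘ₗ Qc ∘ₗ Gp) + (B9Eq360Vprime.pPrime Gp (gPrimeExtEnd Gp (conj b (vPrimeConc T U g.eta A blk kQ kF sQ sF cfun) * Gp)) (Qcs ∘ₗ secRes rep) (Qcs' ∘ₗ secRes rep) (secConj rep Linv) (secConj rep Tinv) (secExt rep ∘ₗ Qc) (secExt rep ∘ₗ Qc'))))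
            ∘ₗ conjHom b (divLin T ((g.eta : ℂ)⁻¹) (prodCfg U g.eta A))) Qs' a Q' = 1 ∧
      HasKernelBound (g := toB6 g Rr H) (fun q : (κ × S) × ι => blk q.1.2) v c GExt
        (fun a a' => B * g.len a ^ 2 * Real.exp (-(1 / 10 * δ₀ * g.dist a a'))) ∧
      (∀ k : κ ⊕ κ, HasKernelBound (g := toB6 g Rr H) (fun q : (κ × S) × ι => blk q.1.2) v c
        (conj b (diffLetter (bT T) (bU U) ((g.eta : ℂ)⁻¹) k) * GExt)
        (fun a a' => B * g.len a * Real.exp (-(1 / 10 * δ₀ * g.dist a a')))) ∧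
      (∀ l : κ ⊕ κ, HasKernelBound (g := toB6 g Rr H) (fun q : (κ × S) × ι => blk q.1.2) v c
        (GExt * conj b (diffLetter (bT T) (bU U) ((g.eta : ℂ)⁻¹) l))
        (fun a a' => B * g.len a * Real.exp (-(1 / 10 * δ₀ * g.dist a a')))) ∧
      (∀ k l : κ ⊕ κ, HasKernelBound (g := toB6 g Rr H) (fun q : (κ × S) × ι => blk q.1.2) v c
        (conj b (diffLetter (bT T) (bU U) ((g.eta : ℂ)⁻¹) k) * GExt * conj b (diffLetter (bT T) (bU U) ((g.eta : ℂ)⁻¹) l))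
        (fun a a' => B * Real.exp (-(1 / 10 * δ₀ * g.dist a a')))) ∧
      -- (iv) THEOREM 3.4 FOR `R(U′U)`, second half (FILE 33): (3.68) `P(U′U) = P(U) + P′(A)` and the four entries of `P′(A)` in the printed kernel form
      B9Eq360Vprime.pOp (gPrimeExtEnd Gp (conj b (vPrimeConc T U g.eta A blk kQ kF sQ sF cfun) * Gp)) (Qcs' ∘ₗ secRes rep) (secConj rep Tinv) (secExt rep ∘ₗ Qc') =
        B9Eq360Vprime.pOp Gp (Qcs ∘ₗ secRes rep) (secConj rep Linv) (secExt rep ∘ₗ Qc) + B9Eq360Vprime.pPrime Gp (gPrimeExtEnd Gp (conj b (vPrimeConc T U g.eta A blk kQ kF sQ sF cfun) * Gp)) (Qcs ∘ₗ secRes rep) (Qcs' ∘ₗ secRes rep) (secConj rep Linv) (secConj rep Tinv) (secExt rep ∘ₗ Qc) (secExt rep ∘ₗ Qc') ∧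
      HasKernelBound (g := toB6 g Rr H) (fun p : S × ι => blk p.1) v c (B9Eq360Vprime.pPrime Gp (gPrimeExtEnd Gp (conj b (vPrimeConc T U g.eta A blk kQ kF sQ sF cfun) * Gp)) (Qcs ∘ₗ secRes rep) (Qcs' ∘ₗ secRes rep) (secConj rep Linv) (secConj rep Tinv) (secExt rep ∘ₗ Qc) (secExt rep ∘ₗ Qc'))
        (fun a a' => B * α₁ * Real.exp (-(1 / 5 * δ₀ * g.dist a a'))) ∧
      (∀ k : κ ⊕ κ, HasKernelBound (g := toB6 g Rr H) (fun p : S × ι => blk p.1) v c (conj b (diffLetter T U ((g.eta : ℂ)⁻¹) k) * B9Eq360Vprime.pPrime Gp (gPrimeExtEnd Gp (conj b (vPrimeConc T U g.eta A blk kQ kF sQ sF cfun) * Gp)) (Qcs ∘ₗ secRes rep) (Qcs' ∘ₗ secRes rep) (secConj rep Linv) (secConj rep Tinv) (secExt rep ∘ₗ Qc) (secExt rep ∘ₗ Qc'))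
        (fun a a' => B * α₁ * (g.len a)⁻¹ * Real.exp (-(1 / 5 * δ₀ * g.dist a a')))) ∧
      (∀ l : κ ⊕ κ, HasKernelBound (g := toB6 g Rr H) (fun p : S × ι => blk p.1) v c (B9Eq360Vprime.pPrime Gp (gPrimeExtEnd Gp (conj b (vPrimeConc T U g.eta A blk kQ kF sQ sF cfun) * Gp)) (Qcs ∘ₗ secRes rep) (Qcs' ∘ₗ secRes rep) (secConj rep Linv) (secConj rep Tinv) (secExt rep ∘ₗ Qc) (secExt rep ∘ₗ Qc') * conj b (diffLetter T U ((g.eta : ℂ)⁻¹) l))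
        (fun a a' => B * α₁ * (g.len a)⁻¹ * Real.exp (-(1 / 5 * δ₀ * g.dist a a')))) ∧
      (∀ k l : κ ⊕ κ, HasKernelBound (g := toB6 g Rr H) (fun p : S × ι => blk p.1) v c (conj b (diffLetter T U ((g.eta : ℂ)⁻¹) k) * B9Eq360Vprime.pPrime Gp (gPrimeExtEnd Gp (conj b (vPrimeConc T U g.eta A blk kQ kF sQ sF cfun) * Gp)) (Qcs ∘ₗ secRes rep) (Qcs' ∘ₗ secRes rep) (secConj rep Linv) (secConj rep Tinv) (secExt rep ∘ₗ Qc) (secExt rep ∘ₗ Qc') * conj b (diffLetter T U ((g.eta : ℂ)⁻¹) l))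
        (fun a a' => B * α₁ * (g.len a ^ 2)⁻¹ * Real.exp (-(1 / 5 * δ₀ * g.dist a a')))) ∧
      -- (v) p. 403 L7–9 (FILE 32): «the remainders G′(U)V′(A)G′(U′U) and G′(U′U)V′(A)G′(U) in (3.65) … satisfy Theorem 3.1 with the additional small
      -- factor O(1)α₁» — both remainders `= G′(U′U) − G′(U)`, four (3.42) entries in the printed kernel form
      Gp * conj b (vPrimeConc T U g.eta A blk kQ kF sQ sF cfun) * (gPrimeExtEnd Gp (conj b (vPrimeConc T U g.eta A blk kQ kF sQ sF cfun) * Gp)) = gPrimeExtEnd Gp (conj b (vPrimeConc T U g.eta A blk kQ kF sQ sF cfun) * Gp) - Gp ∧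
      (gPrimeExtEnd Gp (conj b (vPrimeConc T U g.eta A blk kQ kF sQ sF cfun) * Gp)) * conj b (vPrimeConc T U g.eta A blk kQ kF sQ sF cfun) * Gp = gPrimeExtEnd Gp (conj b (vPrimeConc T U g.eta A blk kQ kF sQ sF cfun) * Gp) - Gp ∧
      HasKernelBound (g := toB6 g Rr H) (fun p : S × ι => blk p.1) v c (gPrimeExtEnd Gp (conj b (vPrimeConc T U g.eta A blk kQ kF sQ sF cfun) * Gp) - Gp)
        (fun a a' => B * α₁ * g.len a ^ 2 * Real.exp (-(4 / 5 * δ₀ * g.dist a a'))) ∧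
      (∀ k : κ ⊕ κ, HasKernelBound (g := toB6 g Rr H) (fun p : S × ι => blk p.1) v c (conj b (diffLetter T U ((g.eta : ℂ)⁻¹) k) * (gPrimeExtEnd Gp (conj b (vPrimeConc T U g.eta A blk kQ kF sQ sF cfun) * Gp) - Gp))
        (fun a a' => B * α₁ * g.len a * Real.exp (-(4 / 5 * δ₀ * g.dist a a')))) ∧
      (∀ l : κ ⊕ κ, HasKernelBound (g := toB6 g Rr H) (fun p : S × ι => blk p.1) v c ((gPrimeExtEnd Gp (conj b (vPrimeConc T U g.eta A blk kQ kF sQ sF cfun) * Gp) - Gp) * conj b (diffLetter T U ((g.eta : ℂ)⁻¹) l))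
        (fun a a' => B * α₁ * g.len a * Real.exp (-(4 / 5 * δ₀ * g.dist a a')))) ∧
      (∀ k l : κ ⊕ κ, HasKernelBound (g := toB6 g Rr H) (fun p : S × ι => blk p.1) v c (conj b (diffLetter T U ((g.eta : ℂ)⁻¹) k) * (gPrimeExtEnd Gp (conj b (vPrimeConc T U g.eta A blk kQ kF sQ sF cfun) * Gp) - Gp) * conj b (diffLetter T U ((g.eta : ℂ)⁻¹) l))
        (fun a a' => B * α₁ * Real.exp (-(4 / 5 * δ₀ * g.dist a a')))) := by
  classical
  obtain ⟨a₁, ha₁, B₁', hB₁', HA⟩ := thm34_all_kernel_uniform b κ d δ₀ B₀ κQ BG B₁ cF Cq a₀ C₀ d₀ M₂ κQb cFb abar Λf hB₀ hκQ hBG hB₁ hcF hCq ha₀ hC₀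
    hM₂ hδ₀ hκQb hcFb habar hΛf hrepr
  obtain ⟨a₂, ha₂, B₂, hB₂, HD⟩ := thm34_pPrime_kernel_uniform b κ d δ₀ κQ BG B₁ cF Cq a₀ d₀ M₂ Λf hκQ hBG hB₁ hcF hCq ha₀ hM₂ hδ₀ hΛf hrepr
  obtain ⟨a₃, ha₃, B₃, hB₃, HE⟩ := remainder365_kernel_uniform b κ d δ₀ BG Cq a₀ d₀ M₂ Λf hBG hCq ha₀ hM₂ hδ₀ hΛf hrepr
  refine ⟨min (min a₁ a₂) a₃, lt_min (lt_min ha₁ ha₂) ha₃, B₁' + B₂ + B₃, add_nonneg (add_nonneg hB₁' hB₂) hB₃, ?_⟩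
  -- NOW the lattice, the background, the data, the Theorems-for-`U` inputs (block and kernel members); then `α₁`, `A` and the `A`-letters
  intro S _ _ T U g _ _ _ Rr H blk kQ sQ cfun w hdnn htri hrefl hsym hlen hlenη hη hL h261 hST hT hU1 h35 hd₀B hd₀F hd₀FB hd₀st hd₀loc hd₀0 hw hcard
    hkQ hsQ hcfun Gp h342_1 h342_2 h342_3 Δp hΔpGp hGpΔp rep hrep Qc Qcs Linv hQc hQcs hLinv h348 G Qs Q a hQb hQsb ha324 hΔG hGΔ hG hDG hGD v hv c
    hc hGk hDGk hGDk hDGDk hGpk hDGpk hGpDk hDGpDk α₁ hα₁0 hα₁1 A kF sF hkF hsF h337B h337F h337B' h337Bτ h337FB hA hAτB hAτF hAFB hAst hAloc hdAst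
    Qc' Fc Qcs' Fcs h357 h357s hFc hFcs P₂ Qs' Q' F₂ F₂s h380 h380s hP₂def hF₂ hF₂s
  replace HA := HA T U blk kQ sQ cfun w hdnn htri hrefl hsym hlen hlenη hη hL h261 hST hT hU1 h35 hd₀B hd₀F hd₀FB hd₀st hd₀loc hd₀0 hw hcard hkQ hsQ
    hcfun h342_1 h342_2 h342_3 hΔpGp hGpΔp rep hrep hQc hQcs hLinv h348 hQb hQsb ha324 hΔG hGΔ hG hDG hGD hv hc hGk hDGk hGDk hDGDk hGpk hDGpk hGpDk
    hDGpDk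
  replace HD := HD T U blk kQ sQ cfun w hdnn htri hrefl hsym hlen hlenη hη h261 hST hU1 hd₀B hd₀F hd₀0 hw hcard hkQ hsQ hcfun h342_1 h342_2 h342_3
    rep hrep hQc hQcs hLinv h348 hΔpGp hGpΔp hv hc hGpk hDGpk hGpDk hDGpDk
  replace HE := HE T U blk kQ sQ cfun w hdnn htri hrefl hsym hlen hlenη hη h261 hST hU1 hd₀B hd₀F hd₀0 hw hcard hkQ hsQ hcfun hΔpGp hGpΔp h342_1
    h342_2 h342_3 hv hc hGpk hDGpk hGpDk hDGpDk
  have hα₁a : α₁ ≤ a₁ := hα₁1.trans ((min_le_left _ _).trans (min_le_left _ _))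
  have hα₁b : α₁ ≤ a₂ := hα₁1.trans ((min_le_left _ _).trans (min_le_right _ _))
  have hα₁c : α₁ ≤ a₃ := hα₁1.trans (min_le_right _ _)
  obtain ⟨i1, i2, k1, k2, k3, k4, Tinv, GExt, e1, e2, hTk, p1, p2, p3, p4, e3, e4, g1, g2, g3, g4⟩ := HA α₁ hα₁0 hα₁a A kF sF hkF
    hsF h337B h337F h337B' h337Bτ h337FB hA hAτB hAτF hAFB hAst hAloc hdAst h357 h357s hFc hFcs h380 h380s hP₂def hF₂ hF₂s
  obtain ⟨Tinv₄, f1, -, h368, d1, d2, d3, d4⟩ := HD α₁ hα₁0 hα₁b A kF sF hkF hsF h337B h337F h337Bτ hA hAτB h357 h357s hFc hFcs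
  obtain ⟨r1, r2, s1, s2, s3, s4⟩ := HE α₁ hα₁0 hα₁c A kF sF hkF hsF h337B h337F h337Bτ hA hAτB
  -- the two `C⁻¹(U′U)` agree (uniqueness of the two-sided inverse)
  have hT4 : Tinv₄ = Tinv := left_inv_eq_right_inv f1 e2
  rw [hT4] at h368 d1 d2 d3 d4
  -- one constant `B`; the (3.68) rate `δ₀/4 ↦ δ₀/5`
  have hle1 : B₁' ≤ B₁' + B₂ + B₃ := by linarith only [hB₂, hB₃]
  have hle2 : B₂ * α₁ ≤ (B₁' + B₂ + B₃) * α₁ := mul_le_mul_of_nonneg_right (by linarith only [hB₁', hB₃]) hα₁0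
  have hle3 : B₃ * α₁ ≤ (B₁' + B₂ + B₃) * α₁ := mul_le_mul_of_nonneg_right (by linarith only [hB₁', hB₂]) hα₁0
  have hBα : 0 ≤ (B₁' + B₂ + B₃) * α₁ := mul_nonneg (add_nonneg (add_nonneg hB₁' hB₂) hB₃) hα₁0
  have hw1i : ∀ a : g.Site, 0 ≤ (g.len a)⁻¹ := fun a => inv_nonneg.mpr (hlen a).le
  have hw2i : ∀ a : g.Site, 0 ≤ (g.len a ^ 2)⁻¹ := fun a => inv_nonneg.mpr (sq_nonneg _)
  have hw1 : ∀ a : g.Site, 0 ≤ g.len a := fun a => (hlen a).le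
  have hw2 : ∀ a : g.Site, 0 ≤ g.len a ^ 2 := fun a => sq_nonneg _
  have hexp : ∀ a a' : g.Site, Real.exp (-(1 / 4 * δ₀ * g.dist a a')) ≤ Real.exp (-(1 / 5 * δ₀ * g.dist a a')) := fun a a' => by
    have h0 : 0 ≤ δ₀ * g.dist a a' := mul_nonneg hδ₀.le (hdnn a a')
    exact Real.exp_le_exp.mpr (by linarith)
  refine ⟨i1, i2, ?_, fun k => ?_, fun l => ?_, fun k l => ?_, Tinv, GExt, e1, e2, fun y y' => ?_, ?_, fun k => ?_, fun l => ?_,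
    fun k l => ?_, e3, e4, ?_, fun k => ?_, fun l => ?_, fun k l => ?_, h368, ?_, fun k => ?_, fun l => ?_, fun k l => ?_, r1, r2, ?_,
    fun k => ?_, fun l => ?_, fun k l => ?_⟩
  · exact hasKernelBound_mono (g := toB6 g Rr H) _ hv k1 fun a a' =>
      mul_le_mul_of_nonneg_right (mul_le_mul_of_nonneg_right hle1 (hw2 a)) (Real.exp_nonneg _)
  · exact hasKernelBound_mono (g := toB6 g Rr H) _ hv (k2 k) fun a a' =>
      mul_le_mul_of_nonneg_right (mul_le_mul_of_nonneg_right hle1 (hw1 a)) (Real.exp_nonneg _)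
  · exact hasKernelBound_mono (g := toB6 g Rr H) _ hv (k3 l) fun a a' =>
      mul_le_mul_of_nonneg_right (mul_le_mul_of_nonneg_right hle1 (hw1 a)) (Real.exp_nonneg _)
  · exact hasKernelBound_mono (g := toB6 g Rr H) _ hv (k4 k l) fun a a' => mul_le_mul_of_nonneg_right hle1 (Real.exp_nonneg _)
  · exact (hTk y y').trans (mul_le_mul_of_nonneg_right (mul_le_mul_of_nonneg_right (mul_le_mul_of_nonneg_right hle1
      (Real.rpow_nonneg (hlen y).le _)) (Real.rpow_nonneg (hlen y').le _)) (Real.exp_nonneg _))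
  · exact hasKernelBound_mono (g := toB6 g Rr H) _ hv p1 fun a a' => mul_le_mul_of_nonneg_right hle1 (Real.exp_nonneg _)
  · exact hasKernelBound_mono (g := toB6 g Rr H) _ hv (p2 k) fun a a' =>
      mul_le_mul_of_nonneg_right (mul_le_mul_of_nonneg_right hle1 (hw1i a)) (Real.exp_nonneg _)
  · exact hasKernelBound_mono (g := toB6 g Rr H) _ hv (p3 l) fun a a' =>
      mul_le_mul_of_nonneg_right (mul_le_mul_of_nonneg_right hle1 (hw1i a)) (Real.exp_nonneg _)
  · exact hasKernelBound_mono (g := toB6 g Rr H) _ hv (p4 k l) fun a a' =>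
      mul_le_mul_of_nonneg_right (mul_le_mul_of_nonneg_right hle1 (hw2i a)) (Real.exp_nonneg _)
  · exact hasKernelBound_mono (g := toB6 g Rr H) _ hv g1 fun a a' =>
      mul_le_mul_of_nonneg_right (mul_le_mul_of_nonneg_right hle1 (hw2 a)) (Real.exp_nonneg _)
  · exact hasKernelBound_mono (g := toB6 g Rr H) _ hv (g2 k) fun a a' =>
      mul_le_mul_of_nonneg_right (mul_le_mul_of_nonneg_right hle1 (hw1 a)) (Real.exp_nonneg _)
  · exact hasKernelBound_mono (g := toB6 g Rr H) _ hv (g3 l) fun a a' =>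
      mul_le_mul_of_nonneg_right (mul_le_mul_of_nonneg_right hle1 (hw1 a)) (Real.exp_nonneg _)
  · exact hasKernelBound_mono (g := toB6 g Rr H) _ hv (g4 k l) fun a a' => mul_le_mul_of_nonneg_right hle1 (Real.exp_nonneg _)
  · exact hasKernelBound_mono (g := toB6 g Rr H) _ hv d1 fun a a' => mul_le_mul hle2 (hexp a a') (Real.exp_pos _).le hBα
  · exact hasKernelBound_mono (g := toB6 g Rr H) _ hv (d2 k) fun a a' =>
      mul_le_mul (mul_le_mul_of_nonneg_right hle2 (hw1i a)) (hexp a a') (Real.exp_pos _).le (mul_nonneg hBα (hw1i a))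
  · exact hasKernelBound_mono (g := toB6 g Rr H) _ hv (d3 l) fun a a' =>
      mul_le_mul (mul_le_mul_of_nonneg_right hle2 (hw1i a)) (hexp a a') (Real.exp_pos _).le (mul_nonneg hBα (hw1i a))
  · exact hasKernelBound_mono (g := toB6 g Rr H) _ hv (d4 k l) fun a a' =>
      mul_le_mul (mul_le_mul_of_nonneg_right hle2 (hw2i a)) (hexp a a') (Real.exp_pos _).le (mul_nonneg hBα (hw2i a))
  · exact hasKernelBound_mono (g := toB6 g Rr H) _ hv s1 fun a a' =>
      mul_le_mul_of_nonneg_right (mul_le_mul_of_nonneg_right hle3 (hw2 a)) (Real.exp_nonneg _)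
  · exact hasKernelBound_mono (g := toB6 g Rr H) _ hv (s2 k) fun a a' =>
      mul_le_mul_of_nonneg_right (mul_le_mul_of_nonneg_right hle3 (hw1 a)) (Real.exp_nonneg _)
  · exact hasKernelBound_mono (g := toB6 g Rr H) _ hv (s3 l) fun a a' =>
      mul_le_mul_of_nonneg_right (mul_le_mul_of_nonneg_right hle3 (hw1 a)) (Real.exp_nonneg _)
  · exact hasKernelBound_mono (g := toB6 g Rr H) _ hv (s4 k l) fun a a' => mul_le_mul_of_nonneg_right hle3 (Real.exp_nonneg _)

end AllU

end Literature.MathematicalPhysics.QuantumFieldTheory.Balaban1983to89.B9Thm34AllKernelUniform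

end
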